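import Literature.Probability.RandomPlanarGeometry.SLERSObservableIto
import Literature.Probability.RandomPlanarGeometry.SLEPointSwallowingKernel
import Literature.Probability.RandomPlanarGeometry.ObservableAdapted
import Literature.Probability.Process.MartingaleLimit
import Mathlib.Analysis.SpecialFunctions.Complex.Analytic
import HarnessLib

/-!
# The FK-Ising martingale observable of SLE(16/3): `√(iy g_t'(iy)/(g_t(iy) - W_t))` is a martingale

Topic `Literature/Probability/RandomPlanarGeometry` (family `crit-ising`); theorems only, no
definition and no named fact. Written in support of the named fact
`Literature.Probability.LatticeModels.exists_cylinderObservableIdentity_fkInterface` (M5′)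
(`LatticeModels/FKIsingNaturalMartingale.lean`): the cylinder identity
`E[(N^y_t - N^y_s) ψ(W_S)] = 0` for the time-limited FK observable process
`N^y_t = Loewner.observableProcess W y t = (iy g'/(g - W))^{1/2}_{t ∧ y²/9}` and a version `W` of
the driving process of a subsequential scaling limit of the critical FK-Ising interfaces. Since
that limit is chordal SLE(16/3) (Chelkak–Duminil-Copin–Hongler–Kemppainen–Smirnov, C. R. Math.
352 (2014), Thm. 2; tree: the named fact `isSLELaw_of_isSubseqLimitLaw_fkInterfaceCurve`), the
identity (M5′) amounts to the continuum statement that the FK observable of the Loewner chain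
driven by `√(16/3) B` is a martingale — Duminil-Copin–Smirnov, Clay Math. Proc. 15 (2012), proof
of Prop. 6.7, p. 29: "if `γ` is an SLE(16/3) … `√π M_t^z = √(g_t'(z)/(g_t(z) - W_t))` is a
martingale". This file PROVES that statement on the canonical space:

* `martingale_re_im_observableProcess_sle` — for `κ = 16/3` and `y > 0` the real and imaginary
  parts of `N^y = Loewner.observableProcess (√κ B) y` are martingales of the raw Brownian
  filtration under the pre-Wiener measure;
* `integral_observableProcess_cylinder_sle` — hence the cylinder identity of (M5′) for the
  SLE(16/3) driving process (bounded `𝓕_s`-measurable multipliers test martingales,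
  `integral_sub_mul_eq_zero_of_martingale`).

## The argument (Itô's formula in slope coordinates)

With `z_t = g_t(iy) - W_t = x_t + i y_t`, `w_t = x_t/y_t` (`dw = 4w/|z|² dt - (√κ/y) dB`,
Rohde–Schramm's slope, tree `SLEPointFlowStopped`/`SLERSObservableIto`), `ψ_t = y|g_t'|/y_t =
exp ∫ 4y²/|z|⁴` and `arg g_t' = Im ∫ -2/z² = ∫ 4xy/|z|⁴`, the square of the observable is
`iy g_t'/z_t = i e^{Λ_t}/(w_t + i)`, `Λ_t = ∫₀ᵗ (4y² + 4ixy)/|z|⁴ ds` (`fkObservable_base_eq`,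
from `Loewner.hasDerivAt_map` and `derivRatio_eq_exp`), so that along `[0, y²/9]` the observable
is the continuous square root `i^{1/2} e^{Λ_t/2} (w_t + i)^{-1/2}`
(`stoppedProcess_observableProcess_eq`; uniqueness of continuous square roots,
`eq_of_sq_eq_of_continuousOn`). For `h(w) = (w + i)^{-1/2}` the Itô drift of `e^{Λ/2} h(w)` is
`y⁻² e^{Λ/2} [(κ/2) h'' + (4w/(1+w²)) h' + (2(1+iw)/(1+w²)²) h](w)` (`fkObservable_itoDrift_eq_zero`)
and the bracket vanishes identically iff `3κ/8 = 2`, i.e. `κ = 16/3` (`slopeFun_ode`). The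
stochastic calculus (`martingale_re_im_fkProduct`) is run on real and imaginary parts with the
tree's Itô formula for Itô processes (`ito_formula_itoProcess_ae_holds`), the product rule
(`ae_mul_eq_of_isItoProcess`) and square-integrable Itô integrals of bounded progressive
integrands (`exists_isItoIntegral_of_abs_le`), along the flows stopped at `σ ≤ ρₙ ∧ y²/9` with
bounded slope (the localization of Rohde–Schramm (2005), proof of Lemma 6.3, as in
`SLERSObservableIto.lean`); the localization is removed by bounded convergence
(`Process.martingale_of_tendsto_of_abs_le'`: the observable is bounded by `2`,
`Loewner.norm_observableProcess_le`).

## References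

* H. Duminil-Copin, S. Smirnov, *Conformal invariance of lattice models*, Clay Math. Proc. 15
  (2012) 213–276 (arXiv:1109.1549), proof of Prop. 6.7 (p. 29). [DuminilCopinSmirnov2012Clay]
* D. Chelkak, H. Duminil-Copin, C. Hongler, A. Kemppainen, S. Smirnov, C. R. Math. Acad. Sci.
  Paris 352 (2014) 157–161, §3 ("`M_t(z)`, `t ≤ T(z) = (Im w)²/9`, is a martingale"). [CDHKSCRAS2014]
* S. Rohde, O. Schramm, *Basic properties of SLE*, Ann. of Math. 161 (2005), proof of Lemma 6.3
  (the slope `w_t` and the localization), eq. (3.3), (6.3). [RohdeSchramm2005]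
* D. Revuz, M. Yor, *Continuous Martingales and Brownian Motion* (1999), Ch. IV, Prop. (3.1),
  Thm (3.3). [RevuzYor1999]
-/

noncomputable section

open MeasureTheory ProbabilityTheory Filter Set Topology Complex
open scoped NNReal ENNReal

namespace Literature.Probability.RandomPlanarGeometry

open Loewner Literature.Probability.Process Literature.Analysis.FunctionSpaces

/-! ### The function `h(w) = (w + i)^c` of the slope along the real line -/

/-- `‖(w + i)^c‖ = ‖w + i‖^{c}` for real exponents `c`. [folklore] -/
theorem norm_ofReal_add_I_cpow (w : ℝ) (c : ℝ) :
    ‖((w : ℂ) + I) ^ (c : ℂ)‖ = ‖((w : ℂ) + I)‖ ^ c := by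
  rw [norm_cpow_of_ne_zero (ofReal_add_I_ne_zero w)]; simp

/-- `‖(w + i)^{c}‖ ≤ 1` for `c ≤ 0` (`‖w + i‖ ≥ 1`). [folklore] -/
theorem norm_ofReal_add_I_cpow_le_one (w : ℝ) {c : ℝ} (hc : c ≤ 0) :
    ‖((w : ℂ) + I) ^ (c : ℂ)‖ ≤ 1 := by
  rw [norm_ofReal_add_I_cpow]
  exact Real.rpow_le_one_of_one_le_of_nonpos (one_le_norm_ofReal_add_I w) hc

/-- The derivative of `w ↦ (w + i)^c` along the real line: `c (w + i)^{c-1}`. [folklore] -/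
theorem hasDerivAt_ofReal_add_I_cpow (c : ℂ) (w : ℝ) :
    HasDerivAt (fun v : ℝ => ((v : ℂ) + I) ^ c) (c * ((w : ℂ) + I) ^ (c - 1)) w := by
  have h1 : HasDerivAt (fun x : ℂ => (x + I) ^ c) (c * ((w : ℂ) + I) ^ (c - 1) * 1) (w : ℂ) :=
    ((hasDerivAt_id (w : ℂ)).add_const I).cpow_const (ofReal_add_I_mem_slitPlane w)
  rw [mul_one] at h1
  exact h1.comp_ofReal

/-- `d/dw Re (w+i)^c = Re (c (w+i)^{c-1})`. [folklore] -/
theorem deriv_re_ofReal_add_I_cpow (c : ℂ) :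
    deriv (fun v : ℝ => (((v : ℂ) + I) ^ c).re) = fun w : ℝ => (c * ((w : ℂ) + I) ^ (c - 1)).re := by
  funext w
  exact (reCLM.hasFDerivAt.comp_hasDerivAt w (hasDerivAt_ofReal_add_I_cpow c w)).deriv

/-- `d/dw Im (w+i)^c = Im (c (w+i)^{c-1})`. [folklore] -/
theorem deriv_im_ofReal_add_I_cpow (c : ℂ) :
    deriv (fun v : ℝ => (((v : ℂ) + I) ^ c).im) = fun w : ℝ => (c * ((w : ℂ) + I) ^ (c - 1)).im := by
  funext w
  exact (imCLM.hasFDerivAt.comp_hasDerivAt w (hasDerivAt_ofReal_add_I_cpow c w)).deriv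

/-- `d/dw Re (c (w+i)^{c-1}) = Re (c (c-1) (w+i)^{c-2})`. [folklore] -/
theorem deriv_re_const_mul_ofReal_add_I_cpow (c : ℂ) :
    deriv (fun v : ℝ => (c * ((v : ℂ) + I) ^ (c - 1)).re) =
      fun w : ℝ => (c * ((c - 1) * ((w : ℂ) + I) ^ (c - 1 - 1))).re := by
  funext w
  exact (reCLM.hasFDerivAt.comp_hasDerivAt w
    ((hasDerivAt_ofReal_add_I_cpow (c - 1) w).const_mul c)).deriv

/-- `d/dw Im (c (w+i)^{c-1}) = Im (c (c-1) (w+i)^{c-2})`. [folklore] -/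
theorem deriv_im_const_mul_ofReal_add_I_cpow (c : ℂ) :
    deriv (fun v : ℝ => (c * ((v : ℂ) + I) ^ (c - 1)).im) =
      fun w : ℝ => (c * ((c - 1) * ((w : ℂ) + I) ^ (c - 1 - 1))).im := by
  funext w
  exact (imCLM.hasFDerivAt.comp_hasDerivAt w
    ((hasDerivAt_ofReal_add_I_cpow (c - 1) w).const_mul c)).deriv

/-- Second derivative of `Re (w+i)^c`. [folklore] -/
theorem iteratedDeriv_two_re_ofReal_add_I_cpow (c : ℂ) (w : ℝ) :
    iteratedDeriv 2 (fun v : ℝ => (((v : ℂ) + I) ^ c).re) w =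
      (c * ((c - 1) * ((w : ℂ) + I) ^ (c - 1 - 1))).re := by
  rw [iteratedDeriv_succ, iteratedDeriv_one, deriv_re_ofReal_add_I_cpow,
    deriv_re_const_mul_ofReal_add_I_cpow]

/-- Second derivative of `Im (w+i)^c`. [folklore] -/
theorem iteratedDeriv_two_im_ofReal_add_I_cpow (c : ℂ) (w : ℝ) :
    iteratedDeriv 2 (fun v : ℝ => (((v : ℂ) + I) ^ c).im) w =
      (c * ((c - 1) * ((w : ℂ) + I) ^ (c - 1 - 1))).im := by
  rw [iteratedDeriv_succ, iteratedDeriv_one, deriv_im_ofReal_add_I_cpow,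
    deriv_im_const_mul_ofReal_add_I_cpow]

/-- `w ↦ (w + i)^c` is smooth along the real line (`z ↦ z^c` is analytic on the slit plane).
[folklore] -/
theorem contDiff_ofReal_add_I_cpow (c : ℂ) (n : ℕ∞) : ContDiff ℝ n (fun v : ℝ => ((v : ℂ) + I) ^ c) := by
  rw [contDiff_iff_contDiffAt]
  intro w
  have h1 : AnalyticAt ℂ (fun x : ℂ => x ^ c) ((w : ℂ) + I) :=
    analyticAt_id.cpow analyticAt_const (ofReal_add_I_mem_slitPlane w)
  have h2 : ContDiffAt ℝ n (fun x : ℂ => x ^ c) ((w : ℂ) + I) :=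
    (h1.contDiffAt (n := n)).restrict_scalars ℝ
  have h3 : ContDiff ℝ n (fun v : ℝ => (v : ℂ) + I) := ofRealCLM.contDiff.add contDiff_const
  exact h2.comp w h3.contDiffAt

/-- `Re (w + i)^c` is `C²` along the real line. [folklore] -/
theorem contDiff_re_ofReal_add_I_cpow (c : ℂ) : ContDiff ℝ 2 (fun v : ℝ => (((v : ℂ) + I) ^ c).re) :=
  reCLM.contDiff.comp (contDiff_ofReal_add_I_cpow c 2)

/-- `Im (w + i)^c` is `C²` along the real line. [folklore] -/
theorem contDiff_im_ofReal_add_I_cpow (c : ℂ) : ContDiff ℝ 2 (fun v : ℝ => (((v : ℂ) + I) ^ c).im) :=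
  imCLM.contDiff.comp (contDiff_ofReal_add_I_cpow c 2)

/-! ### The equation at `κ = 16/3` and the vanishing Itô drift -/

/-- **The hypergeometric-type equation of the FK observable at `κ = 16/3`.** With
`h(w) = (w + i)^{c}`, `c = -1/2`, `h' = c (w+i)^{c-1}`, `h'' = c (c-1) (w+i)^{c-2}`:
`(κ/2) h'' + (4w/(1+w²)) h' + (2(1 + iw)/(1+w²)²) h = 0` for `κ/2 = 8/3` — the vanishing of the
Itô drift of `√(g_t'/(g_t - W_t))` exactly at `κ = 16/3` (the bracket is
`(w+i)^c (3κ/8 - 2)·(…)`; Duminil-Copin–Smirnov 2012, proof of Prop. 6.7: the FK martingale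
observable identifies `κ = 16/3`). [cite: DuminilCopinSmirnov2012Clay, Prop. 6.7 (proof, p. 29)] -/
theorem slopeFun_ode (w : ℝ) :
    (8 / 3 : ℂ) * ((-(1 / 2 : ℂ)) * ((-(1 / 2 : ℂ) - 1) * ((w : ℂ) + I) ^ (-(1 / 2 : ℂ) - 1 - 1))) +
      (4 * w / (1 + (w : ℂ) ^ 2)) * ((-(1 / 2 : ℂ)) * ((w : ℂ) + I) ^ (-(1 / 2 : ℂ) - 1)) +
      (2 * (1 + I * w) / (1 + (w : ℂ) ^ 2) ^ 2) * ((w : ℂ) + I) ^ (-(1 / 2 : ℂ)) = 0 := by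
  have hζ := ofReal_add_I_ne_zero w
  have hq : (1 + (w : ℂ) ^ 2) ≠ 0 := by
    have h : (0 : ℝ) < 1 + w ^ 2 := by positivity
    have h' : ((1 + w ^ 2 : ℝ) : ℂ) ≠ 0 := ofReal_ne_zero.2 h.ne'
    push_cast at h'
    exact h'
  have e1 : ((w : ℂ) + I) ^ (-(1 / 2 : ℂ) - 1) = ((w : ℂ) + I) ^ (-(1 / 2 : ℂ)) * ((w : ℂ) + I)⁻¹ := by
    rw [cpow_sub _ _ hζ, cpow_one, div_eq_mul_inv]
  have e2 : ((w : ℂ) + I) ^ (-(1 / 2 : ℂ) - 1 - 1) =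
      ((w : ℂ) + I) ^ (-(1 / 2 : ℂ)) * ((w : ℂ) + I)⁻¹ * ((w : ℂ) + I)⁻¹ := by
    rw [cpow_sub _ _ hζ, cpow_one, e1, div_eq_mul_inv]
  rw [e1, e2]
  set H := ((w : ℂ) + I) ^ (-(1 / 2 : ℂ)) with hH
  have key : (8 / 3 : ℂ) * ((-(1 / 2 : ℂ)) * ((-(1 / 2 : ℂ) - 1) * (H * ((w : ℂ) + I)⁻¹ * ((w : ℂ) + I)⁻¹))) +
      (4 * w / (1 + (w : ℂ) ^ 2)) * ((-(1 / 2 : ℂ)) * (H * ((w : ℂ) + I)⁻¹)) +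
      (2 * (1 + I * w) / (1 + (w : ℂ) ^ 2) ^ 2) * H =
      H * ((2 + 4 * (w : ℂ) ^ 2 + 2 * I * w) * (1 + I ^ 2)) /
        (((w : ℂ) + I) ^ 2 * (1 + (w : ℂ) ^ 2) ^ 2) := by
    field_simp
    ring
  rw [key, I_sq]
  ring
/-- **The Itô drift of `e^{Λ/2} h(w)` vanishes**, given the equation of `slopeFun_ode` at the
slope `w = x/y`: with `dw = (x·2/(y|z|²) + y⁻¹·2x/|z|²) dt - (√κ/y) dB`, `dΛ = (4y² + 4ixy)/|z|⁴ dt`,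
the `dt`-coefficient `h(w)·½Λ' + (b_w h'(w) + ½ σ_w² h''(w))` equals `y⁻²` times the left side of
the equation (`|z|² = y²(1 + w²)`). [cite: DuminilCopinSmirnov2012Clay, Prop. 6.7 (proof, p. 29)] -/
theorem fkObservable_itoDrift_eq_zero (κ : ℝ≥0) {x y : ℝ} {h0 h1 h2 : ℂ} (hy : y ≠ 0)
    (hode : (κ : ℂ) / 2 * h2 + 4 * (x * y⁻¹ : ℝ) / (1 + ((x * y⁻¹ : ℝ) : ℂ) ^ 2) * h1 +
      2 * (1 + I * (x * y⁻¹ : ℝ)) / (1 + ((x * y⁻¹ : ℝ) : ℂ) ^ 2) ^ 2 * h0 = 0) :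
    h0 * ((2⁻¹ : ℂ) * ((loewnerLogDerivRate x y : ℂ) + I * (4 * x * y / (x ^ 2 + y ^ 2) ^ 2 : ℝ))) +
      (((x * loewnerInvImDrift x y + y⁻¹ * loewnerReDrift x y : ℝ) : ℂ) * h1 +
        (2⁻¹ : ℂ) * (((-Real.sqrt κ * y⁻¹) ^ 2 : ℝ) : ℂ) * h2) = 0 := by
  obtain ⟨w, rfl⟩ : ∃ w, x = w * y := ⟨x * y⁻¹, by field_simp⟩
  have hw : w * y * y⁻¹ = w := mul_inv_cancel_right₀ hy w
  rw [hw] at hode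
  have hsq : (-Real.sqrt κ * y⁻¹) ^ 2 = (κ : ℝ) * y⁻¹ ^ 2 := by
    rw [mul_pow, neg_sq, Real.sq_sqrt κ.coe_nonneg]
  have hy' : (y : ℂ) ≠ 0 := ofReal_ne_zero.2 hy
  have hq : (1 + (w : ℂ) ^ 2) ≠ 0 := by
    have h : (0 : ℝ) < 1 + w ^ 2 := by positivity
    have h' : ((1 + w ^ 2 : ℝ) : ℂ) ≠ 0 := ofReal_ne_zero.2 h.ne'
    push_cast at h'
    exact h'
  have key : h0 * ((2⁻¹ : ℂ) * ((loewnerLogDerivRate (w * y) y : ℂ) +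
      I * (4 * (w * y) * y / ((w * y) ^ 2 + y ^ 2) ^ 2 : ℝ))) +
      ((((w * y) * loewnerInvImDrift (w * y) y + y⁻¹ * loewnerReDrift (w * y) y : ℝ) : ℂ) * h1 +
        (2⁻¹ : ℂ) * (((-Real.sqrt κ * y⁻¹) ^ 2 : ℝ) : ℂ) * h2) =
      (y : ℂ)⁻¹ ^ 2 * ((κ : ℂ) / 2 * h2 + 4 * (w : ℝ) / (1 + ((w : ℝ) : ℂ) ^ 2) * h1 +
        2 * (1 + I * (w : ℝ)) / (1 + ((w : ℝ) : ℂ) ^ 2) ^ 2 * h0) := by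
    rw [hsq, loewnerLogDerivRate_apply, loewnerInvImDrift_apply, loewnerReDrift_apply]
    have hN : (w * y) ^ 2 + y ^ 2 = y ^ 2 * (1 + w ^ 2) := by ring
    rw [hN]
    push_cast
    field_simp
    ring
  rw [key, hode, mul_zero]
/-! ### Pathwise calculus: finite-variation factors evaluated at a stopped clock -/

/-- **Fundamental theorem of calculus at a stopped clock** (pathwise, canonical space). If `f` is
differentiable on the real line with continuous derivative `f'`, a process `Fp` reads `f` at the
stopped clock `t ∧ σ`, and the density `a` agrees with `f'` before `σ`, then
`Fp t = Fp 0 + ∫₀ᵗ 𝟙_{s ≤ σ} a s ds`. [folklore] -/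
theorem eq_add_integral_trunc_of_hasDerivAt {σ : (ℝ≥0 → ℝ) → WithTop ℝ≥0} (ω : ℝ≥0 → ℝ)
    {Fp a : ℝ≥0 → (ℝ≥0 → ℝ) → ℝ} {f f' : ℝ → ℝ}
    (hf : ∀ s, HasDerivAt f (f' s) s) (hf' : Continuous f')
    (hF : ∀ s : ℝ≥0, Fp s ω = f ((min (s : WithTop ℝ≥0) (σ ω)).untopA))
    (ha : ∀ s : ℝ≥0, (s : WithTop ℝ≥0) ≤ σ ω → a s ω = f' s) (t : ℝ≥0) :
    Fp t ω = Fp 0 ω + ∫ s in (0 : ℝ)..t, trunc σ a s.toNNReal ω := by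
  have h0 : Fp 0 ω = f 0 := by
    rw [hF]
    congr 1
    have : min ((0 : ℝ≥0) : WithTop ℝ≥0) (σ ω) = (0 : ℝ≥0) := min_eq_left (by exact_mod_cast bot_le)
    rw [this]
    rfl
  set T : ℝ≥0 := (min (t : WithTop ℝ≥0) (σ ω)).untopA with hT
  have hint : (∫ s in (0 : ℝ)..t, trunc σ a s.toNNReal ω) = ∫ s in (0 : ℝ)..T, f' s := by
    have h1 := timeIntegral_trunc a σ t ω
    simp only [timeIntegral] at h1
    rw [h1, ← hT]
    refine intervalIntegral.integral_congr fun r hr ↦ ?_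
    rw [uIcc_of_le (NNReal.coe_nonneg _)] at hr
    have hrσ : ((r.toNNReal : ℝ≥0) : WithTop ℝ≥0) ≤ σ ω := coe_toNNReal_le_of_le_untopA_min hr.2
    rw [ha _ hrσ, Real.coe_toNNReal _ hr.1]
  rw [hint, hF t, ← hT, h0, intervalIntegral.integral_eq_sub_of_hasDerivAt (fun s _ ↦ hf s)
    (hf'.intervalIntegrable _ _)]
  ring

/-! ### The main Itô step -/

section Main

variable {κ : ℝ≥0} {z : ℂ} {n : ℕ} {σ : (ℝ≥0 → ℝ) → WithTop ℝ≥0}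

/-- **Itô step for the FK observable of SLE(16/3).** With the stopped flows `x = x^σ`, `y = y^σ`
(`σ ≤ ρₙ`, slope bounded by `S` on `[0, σ]`), the finite-variation factor
`F = exp(½ ∫₀^{·∧σ} (4y² + 4ixy)/|z|⁴ ds)` and `h(w) = (w + i)^{-1/2}` at the slope `w = x/y`,
the real and imaginary parts of `F · h(w)` are martingales of the raw Brownian filtration under
the pre-Wiener measure (`κ = 16/3`). [cite: DuminilCopinSmirnov2012Clay, Prop. 6.7 (proof, p. 29)] -/
theorem martingale_re_im_fkProduct (hκ : (κ : ℝ) = 16 / 3) (hz : 0 < z.im)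
    (hσ : IsStoppingTime brownianFiltration σ) (hσρ : ∀ ω, σ ω ≤ slePointLocTime κ z n ω)
    {S : ℝ} (hS : ∀ (ω : ℝ≥0 → ℝ) (t : ℝ≥0), (t : WithTop ℝ≥0) ≤ σ ω →
      |cotArg (sleDriving κ ω) z t| ≤ S) :
    Martingale (fun t ω ↦ (Complex.exp ((((timeIntegral (trunc σ fun s ω ↦ loewnerLogDerivRate
        (stoppedProcess (slePointRe κ z) σ s ω) (stoppedProcess (slePointIm κ z) σ s ω)) t ω : ℝ) : ℂ) +
        I * (timeIntegral (trunc σ fun s ω ↦ 4 * stoppedProcess (slePointRe κ z) σ s ω *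
          stoppedProcess (slePointIm κ z) σ s ω / ((stoppedProcess (slePointRe κ z) σ s ω) ^ 2 +
          (stoppedProcess (slePointIm κ z) σ s ω) ^ 2) ^ 2) t ω : ℝ)) / 2) *
        ((((stoppedProcess (slePointRe κ z) σ t ω * (stoppedProcess (slePointIm κ z) σ t ω)⁻¹ : ℝ)) : ℂ)
          + I) ^ (-(1 / 2 : ℂ))).re) brownianFiltration preWienerMeasure ∧
    Martingale (fun t ω ↦ (Complex.exp ((((timeIntegral (trunc σ fun s ω ↦ loewnerLogDerivRate
        (stoppedProcess (slePointRe κ z) σ s ω) (stoppedProcess (slePointIm κ z) σ s ω)) t ω : ℝ) : ℂ) +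
        I * (timeIntegral (trunc σ fun s ω ↦ 4 * stoppedProcess (slePointRe κ z) σ s ω *
          stoppedProcess (slePointIm κ z) σ s ω / ((stoppedProcess (slePointRe κ z) σ s ω) ^ 2 +
          (stoppedProcess (slePointIm κ z) σ s ω) ^ 2) ^ 2) t ω : ℝ)) / 2) *
        ((((stoppedProcess (slePointRe κ z) σ t ω * (stoppedProcess (slePointIm κ z) σ t ω)⁻¹ : ℝ)) : ℂ)
          + I) ^ (-(1 / 2 : ℂ))).im) brownianFiltration preWienerMeasure := by
  haveI := isProbabilityMeasure_preWienerMeasure'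
  have hκ0 : (0 : ℝ) < κ := by rw [hκ]; norm_num
  have hκ0' : 0 < κ := by exact_mod_cast hκ0
  have hσ' : ∀ t : ℝ≥0, MeasurableSet[brownianFiltration t] {ω | σ ω < t} :=
    fun t ↦ hσ.measurableSet_lt t
  have hl0 : 0 < z.im / (n + 2) := (level_pos_lt hz n).1
  -- the processes
  set X : ℝ≥0 → (ℝ≥0 → ℝ) → ℝ := stoppedProcess (slePointRe κ z) σ with hXdef
  set Y : ℝ≥0 → (ℝ≥0 → ℝ) → ℝ := stoppedProcess (slePointIm κ z) σ with hYdef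
  set A : ℝ≥0 → (ℝ≥0 → ℝ) → ℝ := fun t ω ↦ (Y t ω)⁻¹ with hAdef
  set w : ℝ≥0 → (ℝ≥0 → ℝ) → ℝ := fun t ω ↦ X t ω * A t ω with hwdef
  set rateP : ℝ≥0 → (ℝ≥0 → ℝ) → ℝ := fun s ω ↦ loewnerLogDerivRate (X s ω) (Y s ω) with hratePdef
  set argP : ℝ≥0 → (ℝ≥0 → ℝ) → ℝ := fun s ω ↦ 4 * X s ω * Y s ω / ((X s ω) ^ 2 + (Y s ω) ^ 2) ^ 2
    with hargPdef
  set R : ℝ≥0 → (ℝ≥0 → ℝ) → ℝ := timeIntegral (trunc σ rateP) with hRdef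
  set Θ : ℝ≥0 → (ℝ≥0 → ℝ) → ℝ := timeIntegral (trunc σ argP) with hΘdef
  set F₁ : ℝ≥0 → (ℝ≥0 → ℝ) → ℝ := fun t ω ↦ Real.exp (R t ω / 2) * Real.cos (Θ t ω / 2) with hF₁def
  set F₂ : ℝ≥0 → (ℝ≥0 → ℝ) → ℝ := fun t ω ↦ Real.exp (R t ω / 2) * Real.sin (Θ t ω / 2) with hF₂def
  set aF₁u : ℝ≥0 → (ℝ≥0 → ℝ) → ℝ := fun s ω ↦ 2⁻¹ * (rateP s ω * F₁ s ω - argP s ω * F₂ s ω)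
    with haF₁udef
  set aF₂u : ℝ≥0 → (ℝ≥0 → ℝ) → ℝ := fun s ω ↦ 2⁻¹ * (rateP s ω * F₂ s ω + argP s ω * F₁ s ω)
    with haF₂udef
  set c : ℂ := -(1 / 2 : ℂ) with hcdef
  set h₁ : ℝ → ℝ := fun v ↦ (((v : ℂ) + I) ^ c).re with hh₁def
  set h₂ : ℝ → ℝ := fun v ↦ (((v : ℂ) + I) ^ c).im with hh₂def
  set σB : ℝ≥0 → (ℝ≥0 → ℝ) → ℝ := trunc σ (fun _ _ ↦ -Real.sqrt κ) with hσBdef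
  set bX : ℝ≥0 → (ℝ≥0 → ℝ) → ℝ := trunc σ (fun s ω ↦ loewnerReDrift (X s ω) (Y s ω)) with hbXdef
  set aA : ℝ≥0 → (ℝ≥0 → ℝ) → ℝ := trunc σ (fun s ω ↦ loewnerInvImDrift (X s ω) (Y s ω)) with haAdef
  set bw : ℝ≥0 → (ℝ≥0 → ℝ) → ℝ := fun t ω ↦ X t ω * aA t ω + A t ω * bX t ω with hbwdef
  set σw : ℝ≥0 → (ℝ≥0 → ℝ) → ℝ := fun t ω ↦ σB t ω * A t ω with hσwdef
  set D₁ : ℝ≥0 → (ℝ≥0 → ℝ) → ℝ := fun t ω ↦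
    bw t ω * deriv h₁ (w t ω) + 2⁻¹ * σw t ω ^ 2 * iteratedDeriv 2 h₁ (w t ω) with hD₁def
  set D₂ : ℝ≥0 → (ℝ≥0 → ℝ) → ℝ := fun t ω ↦
    bw t ω * deriv h₂ (w t ω) + 2⁻¹ * σw t ω ^ 2 * iteratedDeriv 2 h₂ (w t ω) with hD₂def
  set σG₁ : ℝ≥0 → (ℝ≥0 → ℝ) → ℝ := fun t ω ↦ σw t ω * deriv h₁ (w t ω) with hσG₁def
  set σG₂ : ℝ≥0 → (ℝ≥0 → ℝ) → ℝ := fun t ω ↦ σw t ω * deriv h₂ (w t ω) with hσG₂def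
  -- pathwise values and bounds
  have hYpos : ∀ t ω, 0 < Y t ω := fun t ω ↦ stoppedProcess_slePointIm_pos hz hσρ t ω
  have hYlev : ∀ t ω, z.im / (n + 2) ≤ Y t ω := fun t ω ↦ level_le_stoppedProcess_slePointIm hz hσρ t ω
  have hYle : ∀ t ω, Y t ω ≤ z.im := fun t ω ↦ stoppedProcess_slePointIm_le hz hσρ t ω
  have hwcot : ∀ t ω, w t ω = cotArg (sleDriving κ ω) z ((min (t : WithTop ℝ≥0) (σ ω)).untopA) :=
    fun t ω ↦ by rw [← stopped_div_eq_cotArg hz hσρ t ω, div_eq_mul_inv]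
  have hwS : ∀ t ω, |w t ω| ≤ S := fun t ω ↦ by
    rw [hwcot]; exact hS ω _ (Loewner.coe_untopA_min_le t (σ ω))
  have hS0 : 0 ≤ S := (abs_nonneg _).trans (hwS 0 fun _ ↦ 0)
  have hXbd : ∀ t ω, |X t ω| ≤ S * z.im := fun t ω ↦ by
    have hx : X t ω = w t ω * Y t ω := by
      simp only [hwdef, hAdef]; rw [inv_mul_cancel_right₀ (hYpos t ω).ne']
    rw [hx, abs_mul, abs_of_pos (hYpos t ω)]
    exact mul_le_mul (hwS t ω) (hYle t ω) (hYpos t ω).le hS0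
  have hAbd : ∀ t ω, |A t ω| ≤ (n + 2) / z.im := fun t ω ↦ by
    simp only [hAdef]
    rw [abs_of_pos (inv_pos.2 (hYpos t ω)), inv_eq_one_div, div_le_div_iff₀ (hYpos t ω) hz, one_mul]
    have := hYlev t ω
    rw [div_le_iff₀ (by positivity : (0 : ℝ) < n + 2)] at this
    linarith
  have hσBbd : ∀ t ω, |σB t ω| ≤ Real.sqrt κ := fun t ω ↦ by
    simp only [hσBdef, trunc_apply]
    split_ifs
    · rw [abs_neg, abs_of_nonneg (Real.sqrt_nonneg _)]
    · rw [abs_zero]; exact Real.sqrt_nonneg _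
  -- the finite-variation factor: `exp(R/2) = (ψ^σ)^{1/2}` is bounded
  set CΨ : ℝ := Real.exp (4 / (z.im / (n + 2)) ^ 2 * ((n : ℝ) + 1)) ^ |(1 / 2 : ℝ)| with hCΨdef
  have hexpR : ∀ t ω, Real.exp (R t ω / 2) = stoppedProcess (slePointPsi κ z) σ t ω ^ (1 / 2 : ℝ) := by
    intro t ω
    rw [stoppedProcess_slePointPsi_eq_exp hz hσρ, ← Real.exp_mul]
    congr 1
    simp only [hRdef, hratePdef, hXdef, hYdef]
    ring
  have hexpRbd : ∀ t ω, Real.exp (R t ω / 2) ≤ CΨ := fun t ω ↦ by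
    rw [hexpR]
    exact (le_abs_self _).trans (stoppedProcess_slePointPsi_rpow_le hz hσρ (1 / 2) t ω)
  have hCΨ0 : 0 ≤ CΨ := (Real.exp_pos _).le.trans (hexpRbd 0 fun _ ↦ 0)
  have hF₁bd : ∀ t ω, |F₁ t ω| ≤ CΨ := fun t ω ↦ by
    simp only [hF₁def]
    rw [abs_mul, abs_of_pos (Real.exp_pos _)]
    calc Real.exp (R t ω / 2) * |Real.cos (Θ t ω / 2)| ≤ CΨ * 1 :=
          mul_le_mul (hexpRbd t ω) (Real.abs_cos_le_one _) (abs_nonneg _) hCΨ0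
      _ = CΨ := mul_one _
  have hF₂bd : ∀ t ω, |F₂ t ω| ≤ CΨ := fun t ω ↦ by
    simp only [hF₂def]
    rw [abs_mul, abs_of_pos (Real.exp_pos _)]
    calc Real.exp (R t ω / 2) * |Real.sin (Θ t ω / 2)| ≤ CΨ * 1 :=
          mul_le_mul (hexpRbd t ω) (Real.abs_sin_le_one _) (abs_nonneg _) hCΨ0
      _ = CΨ := mul_one _
  -- bounds for `h, h', h''`
  have hc1 : ContDiff ℝ 2 h₁ := contDiff_re_ofReal_add_I_cpow c
  have hc2 : ContDiff ℝ 2 h₂ := contDiff_im_ofReal_add_I_cpow c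
  have hd1 : deriv h₁ = fun v : ℝ ↦ (c * ((v : ℂ) + I) ^ (c - 1)).re := deriv_re_ofReal_add_I_cpow c
  have hd2 : deriv h₂ = fun v : ℝ ↦ (c * ((v : ℂ) + I) ^ (c - 1)).im := deriv_im_ofReal_add_I_cpow c
  have hdd1 : ∀ v, iteratedDeriv 2 h₁ v = (c * ((c - 1) * ((v : ℂ) + I) ^ (c - 1 - 1))).re :=
    iteratedDeriv_two_re_ofReal_add_I_cpow c
  have hdd2 : ∀ v, iteratedDeriv 2 h₂ v = (c * ((c - 1) * ((v : ℂ) + I) ^ (c - 1 - 1))).im :=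
    iteratedDeriv_two_im_ofReal_add_I_cpow c
  have hnorm0 : ∀ v : ℝ, ‖((v : ℂ) + I) ^ c‖ ≤ 1 := fun v ↦ by
    have := norm_ofReal_add_I_cpow_le_one v (c := -(1 / 2 : ℝ)) (by norm_num)
    convert this using 2
    simp [hcdef]
  have hnorm1 : ∀ v : ℝ, ‖c * ((v : ℂ) + I) ^ (c - 1)‖ ≤ 1 := fun v ↦ by
    rw [norm_mul]
    have h1 : ‖((v : ℂ) + I) ^ (c - 1)‖ ≤ 1 := by
      have := norm_ofReal_add_I_cpow_le_one v (c := -(3 / 2 : ℝ)) (by norm_num)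
      convert this using 2
      simp only [hcdef]; push_cast; ring
    have h2 : ‖c‖ ≤ 1 := by simp [hcdef]; norm_num
    calc ‖c‖ * ‖((v : ℂ) + I) ^ (c - 1)‖ ≤ 1 * 1 := mul_le_mul h2 h1 (norm_nonneg _) zero_le_one
      _ = 1 := one_mul _
  have hh₁bd : ∀ v, |h₁ v| ≤ 1 := fun v ↦ (abs_re_le_norm _).trans (hnorm0 v)
  have hh₂bd : ∀ v, |h₂ v| ≤ 1 := fun v ↦ (abs_im_le_norm _).trans (hnorm0 v)
  have hh₁'bd : ∀ v, |deriv h₁ v| ≤ 1 := fun v ↦ by rw [hd1]; exact (abs_re_le_norm _).trans (hnorm1 v)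
  have hh₂'bd : ∀ v, |deriv h₂ v| ≤ 1 := fun v ↦ by rw [hd2]; exact (abs_im_le_norm _).trans (hnorm1 v)
  have hc10 : Continuous h₁ := hc1.continuous
  have hc20 : Continuous h₂ := hc2.continuous
  have hc11 : Continuous (deriv h₁) := hc1.continuous_deriv (by norm_num)
  have hc21 : Continuous (deriv h₂) := hc2.continuous_deriv (by norm_num)
  -- path regularity
  have hXc : ∀ ω, Continuous (X · ω) := fun ω ↦ continuous_stoppedProcess_slePointRe hz hσρ ω
  have hYc : ∀ ω, Continuous (Y · ω) := fun ω ↦ continuous_stoppedProcess_slePointIm hz σ ω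
  have hAc : ∀ ω, Continuous (A · ω) := fun ω ↦ (hYc ω).inv₀ fun t ↦ (hYpos t ω).ne'
  have hwc : ∀ ω, Continuous (w · ω) := fun ω ↦ (hXc ω).mul (hAc ω)
  have hQpos : ∀ t ω, 0 < (X t ω) ^ 2 + (Y t ω) ^ 2 := fun t ω ↦ by
    have := hYpos t ω; positivity
  have hratec : ∀ ω, Continuous (rateP · ω) := fun ω ↦
    continuous_loewnerLogDerivRate_comp (hXc ω) (hYc ω) fun t ↦ hYpos t ω
  have hargc : ∀ ω, Continuous (argP · ω) := fun ω ↦ by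
    simp only [hargPdef]
    exact ((continuous_const.mul (hXc ω)).mul (hYc ω)).div
      ((((hXc ω).pow 2).add ((hYc ω).pow 2)).pow 2) fun t ↦ (pow_pos (hQpos t ω) 2).ne'
  have hrateRc : ∀ ω, Continuous fun r : ℝ ↦ rateP r.toNNReal ω := fun ω ↦
    (hratec ω).comp continuous_real_toNNReal
  have hargRc : ∀ ω, Continuous fun r : ℝ ↦ argP r.toNNReal ω := fun ω ↦
    (hargc ω).comp continuous_real_toNNReal
  have hRint : ∀ ω (t : ℝ≥0), IntegrableOn (fun s : ℝ ↦ trunc σ rateP s.toNNReal ω) (Icc 0 t) :=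
    fun ω t ↦ integrableOn_trunc ((hrateRc ω).continuousOn.integrableOn_compact isCompact_Icc)
  have hΘint : ∀ ω (t : ℝ≥0), IntegrableOn (fun s : ℝ ↦ trunc σ argP s.toNNReal ω) (Icc 0 t) :=
    fun ω t ↦ integrableOn_trunc ((hargRc ω).continuousOn.integrableOn_compact isCompact_Icc)
  have hRc : ∀ ω, Continuous (R · ω) := fun ω ↦ continuous_timeIntegral (hRint ω)
  have hΘc : ∀ ω, Continuous (Θ · ω) := fun ω ↦ continuous_timeIntegral (hΘint ω)
  have hF₁c : ∀ ω, Continuous (F₁ · ω) := fun ω ↦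
    (Real.continuous_exp.comp ((hRc ω).div_const 2)).mul (Real.continuous_cos.comp ((hΘc ω).div_const 2))
  have hF₂c : ∀ ω, Continuous (F₂ · ω) := fun ω ↦
    (Real.continuous_exp.comp ((hRc ω).div_const 2)).mul (Real.continuous_sin.comp ((hΘc ω).div_const 2))
  have hH₁c : ∀ ω, Continuous fun t ↦ h₁ (w t ω) := fun ω ↦ hc10.comp (hwc ω)
  have hH₂c : ∀ ω, Continuous fun t ↦ h₂ (w t ω) := fun ω ↦ hc20.comp (hwc ω)
  -- adaptedness and progressive measurability
  have hXa : StronglyAdapted brownianFiltration X := stronglyAdapted_stoppedProcess_slePointRe hz hσ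
  have hYa : StronglyAdapted brownianFiltration Y := stronglyAdapted_stoppedProcess_slePointIm hz hσ
  have hAa : StronglyAdapted brownianFiltration A := fun t ↦ (hYa t).measurable.inv.stronglyMeasurable
  have hwa : StronglyAdapted brownianFiltration w := fun t ↦ (hXa t).mul (hAa t)
  have hXp : IsStronglyProgressive brownianFiltration X := hXa.isStronglyProgressive_of_continuous hXc
  have hYp : IsStronglyProgressive brownianFiltration Y := hYa.isStronglyProgressive_of_continuous hYc
  have hAp : IsStronglyProgressive brownianFiltration A := hAa.isStronglyProgressive_of_continuous hAc
  have hwp : IsStronglyProgressive brownianFiltration w := hXp.mul hAp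
  have hratep : IsStronglyProgressive brownianFiltration rateP :=
    isStronglyProgressive_comp_pair hXp hYp measurable_loewnerLogDerivRate
  have hargp : IsStronglyProgressive brownianFiltration argP := by
    refine isStronglyProgressive_comp_pair hXp hYp (F := fun x y : ℝ ↦ 4 * x * y / (x ^ 2 + y ^ 2) ^ 2) ?_
    exact Measurable.div ((measurable_const.mul measurable_fst).mul measurable_snd)
      (((measurable_fst.pow_const 2).add (measurable_snd.pow_const 2)).pow_const 2)
  have hRp : IsStronglyProgressive brownianFiltration R :=
    isStronglyProgressive_timeIntegral (isStronglyProgressive_trunc hratep hσ')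
  have hΘp : IsStronglyProgressive brownianFiltration Θ :=
    isStronglyProgressive_timeIntegral (isStronglyProgressive_trunc hargp hσ')
  have hF₁p : IsStronglyProgressive brownianFiltration F₁ := by
    refine isStronglyProgressive_comp_pair hRp hΘp (F := fun r θ : ℝ ↦ Real.exp (r / 2) * Real.cos (θ / 2)) ?_
    exact (Real.measurable_exp.comp (measurable_fst.div_const 2)).mul
      (Real.measurable_cos.comp (measurable_snd.div_const 2))
  have hF₂p : IsStronglyProgressive brownianFiltration F₂ := by
    refine isStronglyProgressive_comp_pair hRp hΘp (F := fun r θ : ℝ ↦ Real.exp (r / 2) * Real.sin (θ / 2)) ?_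
    exact (Real.measurable_exp.comp (measurable_fst.div_const 2)).mul
      (Real.measurable_sin.comp (measurable_snd.div_const 2))
  have hF₁a : StronglyAdapted brownianFiltration F₁ := hF₁p.stronglyAdapted
  have hF₂a : StronglyAdapted brownianFiltration F₂ := hF₂p.stronglyAdapted
  have hH₁a : StronglyAdapted brownianFiltration fun t ω ↦ h₁ (w t ω) := fun t ↦
    hc10.comp_stronglyMeasurable (hwa t)
  have hH₂a : StronglyAdapted brownianFiltration fun t ω ↦ h₂ (w t ω) := fun t ↦
    hc20.comp_stronglyMeasurable (hwa t)
  have hH₁p : IsStronglyProgressive brownianFiltration fun t ω ↦ h₁ (w t ω) :=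
    IsStronglyProgressive.continuous_comp hwp hc10
  have hH₂p : IsStronglyProgressive brownianFiltration fun t ω ↦ h₂ (w t ω) :=
    IsStronglyProgressive.continuous_comp hwp hc20
  have hH₁'p : IsStronglyProgressive brownianFiltration fun t ω ↦ deriv h₁ (w t ω) :=
    IsStronglyProgressive.continuous_comp hwp hc11
  have hH₂'p : IsStronglyProgressive brownianFiltration fun t ω ↦ deriv h₂ (w t ω) :=
    IsStronglyProgressive.continuous_comp hwp hc21
  have hσBp : IsStronglyProgressive brownianFiltration σB :=
    isStronglyProgressive_trunc (isStronglyProgressive_const _ _) hσ'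
  have haAp : IsStronglyProgressive brownianFiltration aA :=
    isStronglyProgressive_trunc (isStronglyProgressive_comp_pair hXp hYp measurable_loewnerInvImDrift) hσ'
  have hσwp : IsStronglyProgressive brownianFiltration σw := hσBp.mul hAp
  have hσG₁p : IsStronglyProgressive brownianFiltration σG₁ := hσwp.mul hH₁'p
  have hσG₂p : IsStronglyProgressive brownianFiltration σG₂ := hσwp.mul hH₂'p
  have hσwbd : ∀ t ω, |σw t ω| ≤ Real.sqrt κ * ((n + 2) / z.im) := fun t ω ↦ by
    simp only [hσwdef]; rw [abs_mul]
    exact mul_le_mul (hσBbd t ω) (hAbd t ω) (abs_nonneg _) (Real.sqrt_nonneg _)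
  have hσG₁bd : ∀ t ω, |σG₁ t ω| ≤ Real.sqrt κ * ((n + 2) / z.im) * 1 := fun t ω ↦ by
    simp only [hσG₁def]; rw [abs_mul]
    exact mul_le_mul (hσwbd t ω) (hh₁'bd _) (abs_nonneg _) (by positivity)
  have hσG₂bd : ∀ t ω, |σG₂ t ω| ≤ Real.sqrt κ * ((n + 2) / z.im) * 1 := fun t ω ↦ by
    simp only [hσG₂def]; rw [abs_mul]
    exact mul_le_mul (hσwbd t ω) (hh₂'bd _) (abs_nonneg _) (by positivity)
  ---------------------------------------------------------------------------
  -- Step 1: `x^σ` is an Itô process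
  have hX : IsItoProcess X bX σB brownian brownianFiltration preWienerMeasure :=
    isItoProcess_stoppedProcess_slePointRe hz hσ hσρ
  ---------------------------------------------------------------------------
  -- Step 2: `w = x · (1/y)` is an Itô process (product rule)
  obtain ⟨KX, hKX, hKXM⟩ := exists_isItoIntegral_of_abs_le (hσBp.mul hXp)
    (C := Real.sqrt κ * (S * z.im)) fun t ω ↦ by
      rw [abs_mul]; exact mul_le_mul (hσBbd t ω) (hXbd t ω) (abs_nonneg _) (Real.sqrt_nonneg _)
  obtain ⟨K, hK, hKM⟩ := exists_isItoIntegral_of_abs_le (hσBp.mul hAp)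
    (C := Real.sqrt κ * ((n + 2) / z.im)) fun t ω ↦ by
      rw [abs_mul]; exact mul_le_mul (hσBbd t ω) (hAbd t ω) (abs_nonneg _) (Real.sqrt_nonneg _)
  have hA0 : ∀ ω, A 0 ω = (z.im)⁻¹ := fun ω ↦ by
    simp only [hAdef, hYdef]; rw [stoppedProcess_slePointIm_zero hz]
  have hAeq : ∀ᵐ ω ∂preWienerMeasure, ∀ t : ℝ≥0, A t ω = A 0 ω + ∫ s in (0 : ℝ)..t, aA s.toNNReal ω :=
    ae_of_all _ fun ω t ↦ by
      rw [hA0]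
      exact inv_stoppedProcess_slePointIm_eq_integral hz hσρ t ω
  have haA : ∀ᵐ ω ∂preWienerMeasure, ∀ t : ℝ≥0,
      IntegrableOn (fun s : ℝ ↦ aA s.toNNReal ω) (Icc 0 t) :=
    ae_of_all _ fun ω t ↦ integrableOn_trunc_loewnerInvImDrift hz hσρ ω _ isCompact_Icc
  have hw : IsItoProcess w bw σw brownian brownianFiltration preWienerMeasure :=
    IsItoProcess.mul_timeIntegral hXa hXc hσBp hX hAa hAc hAeq haA hKX hKXM hK hKM
  ---------------------------------------------------------------------------
  -- Step 3: `h₁(w)`, `h₂(w)` are Itô processes (Itô's formula)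
  obtain ⟨Kw₁, hKw₁, hKw₁M⟩ := exists_isItoIntegral_of_abs_le hσG₁p hσG₁bd
  obtain ⟨Kw₂, hKw₂, hKw₂M⟩ := exists_isItoIntegral_of_abs_le hσG₂p hσG₂bd
  have hf₁' : ContDiff ℝ 2 (Function.uncurry fun (_ : ℝ) (v : ℝ) ↦ h₁ v) := hc1.comp contDiff_snd
  have hf₂' : ContDiff ℝ 2 (Function.uncurry fun (_ : ℝ) (v : ℝ) ↦ h₂ v) := hc2.comp contDiff_snd
  have hito₁ := ito_formula_itoProcess_ae_holds (fun (_ : ℝ) (v : ℝ) ↦ h₁ v) hf₁'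
    (fun t ↦ (hwa t).measurable) hσwp hw (K := Kw₁) (by exact hKw₁)
  have hito₂ := ito_formula_itoProcess_ae_holds (fun (_ : ℝ) (v : ℝ) ↦ h₂ v) hf₂'
    (fun t ↦ (hwa t).measurable) hσwp hw (K := Kw₂) (by exact hKw₂)
  have hG₁int := hw.ae_integrableOn_itoDrift hf₁' hσwp
  have hG₂int := hw.ae_integrableOn_itoDrift hf₂' hσwp
  have hG₁ : IsItoProcess (fun t ω ↦ h₁ (w t ω)) D₁ σG₁ brownian brownianFiltration preWienerMeasure := by
    refine ⟨?_, Kw₁, hKw₁, ?_⟩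
    · filter_upwards [hG₁int] with ω hω t
      have h1 := hω t
      simp only [deriv_const, zero_add] at h1
      exact h1
    · filter_upwards [hito₁] with ω hω t
      have h1 := hω t
      simp only [deriv_const, zero_add] at h1
      exact h1
  have hG₂ : IsItoProcess (fun t ω ↦ h₂ (w t ω)) D₂ σG₂ brownian brownianFiltration preWienerMeasure := by
    refine ⟨?_, Kw₂, hKw₂, ?_⟩
    · filter_upwards [hG₂int] with ω hω t
      have h1 := hω t
      simp only [deriv_const, zero_add] at h1
      exact h1
    · filter_upwards [hito₂] with ω hω t
      have h1 := hω t
      simp only [deriv_const, zero_add] at h1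
      exact h1
  ---------------------------------------------------------------------------
  -- Step 4: the finite-variation factor `F = F₁ + i F₂`: integral representations
  have hclock : ∀ (s : ℝ≥0) (ω : ℝ≥0 → ℝ), (s : WithTop ℝ≥0) ≤ σ ω →
      ((min (s : WithTop ℝ≥0) (σ ω)).untopA : ℝ≥0) = s := fun s ω hs ↦ by
    rw [min_eq_left hs]; rfl
  have hFeq : ∀ ω, (∀ t : ℝ≥0, F₁ t ω = F₁ 0 ω + ∫ s in (0 : ℝ)..t, trunc σ aF₁u s.toNNReal ω) ∧
      (∀ t : ℝ≥0, F₂ t ω = F₂ 0 ω + ∫ s in (0 : ℝ)..t, trunc σ aF₂u s.toNNReal ω) := by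
    intro ω
    -- the real-line functions
    set U : ℝ → ℝ := fun s ↦ ∫ r in (0 : ℝ)..s, rateP r.toNNReal ω with hU
    set V : ℝ → ℝ := fun s ↦ ∫ r in (0 : ℝ)..s, argP r.toNNReal ω with hV
    have hUd : ∀ s, HasDerivAt U (rateP s.toNNReal ω) s := fun s ↦
      ((hrateRc ω).integral_hasStrictDerivAt 0 s).hasDerivAt
    have hVd : ∀ s, HasDerivAt V (argP s.toNNReal ω) s := fun s ↦
      ((hargRc ω).integral_hasStrictDerivAt 0 s).hasDerivAt
    set f₁ : ℝ → ℝ := fun s ↦ Real.exp (U s / 2) * Real.cos (V s / 2) with hf₁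
    set f₂ : ℝ → ℝ := fun s ↦ Real.exp (U s / 2) * Real.sin (V s / 2) with hf₂
    have hfd₁ : ∀ s, HasDerivAt f₁ (2⁻¹ * (rateP s.toNNReal ω * f₁ s - argP s.toNNReal ω * f₂ s)) s := by
      intro s
      have h1 := ((hUd s).div_const 2).exp
      have h2 := ((hVd s).div_const 2).cos
      refine (h1.mul h2).congr_deriv ?_
      simp only [hf₁, hf₂]
      ring
    have hfd₂ : ∀ s, HasDerivAt f₂ (2⁻¹ * (rateP s.toNNReal ω * f₂ s + argP s.toNNReal ω * f₁ s)) s := by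
      intro s
      have h1 := ((hUd s).div_const 2).exp
      have h2 := ((hVd s).div_const 2).sin
      refine (h1.mul h2).congr_deriv ?_
      simp only [hf₁, hf₂]
      ring
    have hf₁c : Continuous f₁ := continuous_iff_continuousAt.2 fun s ↦ (hfd₁ s).continuousAt
    have hf₂c : Continuous f₂ := continuous_iff_continuousAt.2 fun s ↦ (hfd₂ s).continuousAt
    have hd₁c : Continuous fun s ↦ 2⁻¹ * (rateP s.toNNReal ω * f₁ s - argP s.toNNReal ω * f₂ s) :=
      continuous_const.mul (((hrateRc ω).mul hf₁c).sub ((hargRc ω).mul hf₂c))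
    have hd₂c : Continuous fun s ↦ 2⁻¹ * (rateP s.toNNReal ω * f₂ s + argP s.toNNReal ω * f₁ s) :=
      continuous_const.mul (((hrateRc ω).mul hf₂c).add ((hargRc ω).mul hf₁c))
    have hread₁ : ∀ s : ℝ≥0, F₁ s ω = f₁ ((min (s : WithTop ℝ≥0) (σ ω)).untopA) := by
      intro s
      simp only [hF₁def, hf₁, hRdef, hΘdef, hU, hV]
      rw [timeIntegral_trunc, timeIntegral_trunc]
      rfl
    have hread₂ : ∀ s : ℝ≥0, F₂ s ω = f₂ ((min (s : WithTop ℝ≥0) (σ ω)).untopA) := by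
      intro s
      simp only [hF₂def, hf₂, hRdef, hΘdef, hU, hV]
      rw [timeIntegral_trunc, timeIntegral_trunc]
      rfl
    constructor
    · refine eq_add_integral_trunc_of_hasDerivAt ω hfd₁ hd₁c hread₁ ?_
      intro s hs
      change 2⁻¹ * (rateP s ω * F₁ s ω - argP s ω * F₂ s ω) = _
      rw [hread₁, hread₂, hclock s ω hs, Real.toNNReal_coe]
    · refine eq_add_integral_trunc_of_hasDerivAt ω hfd₂ hd₂c hread₂ ?_
      intro s hs
      change 2⁻¹ * (rateP s ω * F₂ s ω + argP s ω * F₁ s ω) = _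
      rw [hread₁, hread₂, hclock s ω hs, Real.toNNReal_coe]
  have hF₁eq : ∀ ω (t : ℝ≥0), F₁ t ω = F₁ 0 ω + ∫ s in (0 : ℝ)..t, trunc σ aF₁u s.toNNReal ω :=
    fun ω ↦ (hFeq ω).1
  have hF₂eq : ∀ ω (t : ℝ≥0), F₂ t ω = F₂ 0 ω + ∫ s in (0 : ℝ)..t, trunc σ aF₂u s.toNNReal ω :=
    fun ω ↦ (hFeq ω).2
  have haF₁c : ∀ ω, Continuous fun r : ℝ ↦ aF₁u r.toNNReal ω := fun ω ↦
    (continuous_const.mul (((hratec ω).mul (hF₁c ω)).sub ((hargc ω).mul (hF₂c ω)))).comp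
      continuous_real_toNNReal
  have haF₂c : ∀ ω, Continuous fun r : ℝ ↦ aF₂u r.toNNReal ω := fun ω ↦
    (continuous_const.mul (((hratec ω).mul (hF₂c ω)).add ((hargc ω).mul (hF₁c ω)))).comp
      continuous_real_toNNReal
  have haF₁int : ∀ᵐ ω ∂preWienerMeasure, ∀ t : ℝ≥0,
      IntegrableOn (fun s : ℝ ↦ trunc σ aF₁u s.toNNReal ω) (Icc 0 t) :=
    ae_of_all _ fun ω t ↦ integrableOn_trunc ((haF₁c ω).continuousOn.integrableOn_compact isCompact_Icc)
  have haF₂int : ∀ᵐ ω ∂preWienerMeasure, ∀ t : ℝ≥0,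
      IntegrableOn (fun s : ℝ ↦ trunc σ aF₂u s.toNNReal ω) (Icc 0 t) :=
    ae_of_all _ fun ω t ↦ integrableOn_trunc ((haF₂c ω).continuousOn.integrableOn_compact isCompact_Icc)
  ---------------------------------------------------------------------------
  -- Step 5: the four products `hⱼ(w) Fᵢ` (product rule)
  have hprod : ∀ {Hq Dq σGq Fq aFq : ℝ≥0 → (ℝ≥0 → ℝ) → ℝ} {CG CH CF : ℝ},
      StronglyAdapted brownianFiltration Hq → (∀ ω, Continuous (Hq · ω)) →
      IsStronglyProgressive brownianFiltration Hq → IsStronglyProgressive brownianFiltration σGq →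
      IsItoProcess Hq Dq σGq brownian brownianFiltration preWienerMeasure →
      (∀ t ω, |σGq t ω| ≤ CG) → (∀ t ω, |Hq t ω| ≤ CH) →
      StronglyAdapted brownianFiltration Fq → (∀ ω, Continuous (Fq · ω)) →
      IsStronglyProgressive brownianFiltration Fq → (∀ t ω, |Fq t ω| ≤ CF) →
      (∀ ω (t : ℝ≥0), Fq t ω = Fq 0 ω + ∫ s in (0 : ℝ)..t, trunc σ aFq s.toNNReal ω) →
      (∀ᵐ ω ∂preWienerMeasure, ∀ t : ℝ≥0,
        IntegrableOn (fun s : ℝ ↦ trunc σ aFq s.toNNReal ω) (Icc 0 t)) →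
      ∃ Kq : ℝ≥0 → (ℝ≥0 → ℝ) → ℝ, Martingale Kq brownianFiltration preWienerMeasure ∧
        ∀ᵐ ω ∂preWienerMeasure, ∀ t : ℝ≥0, Hq t ω * Fq t ω = Hq 0 ω * Fq 0 ω +
          (∫ s in (0 : ℝ)..t, (Hq s.toNNReal ω * trunc σ aFq s.toNNReal ω +
            Fq s.toNNReal ω * Dq s.toNNReal ω)) + Kq t ω := by
    intro Hq Dq σGq Fq aFq CG CH CF hHa hHc hHp hσGp hH hσGbd hHbd hFa hFc hFp hFbd hFeq haFint
    obtain ⟨KX', hKX', hKX'M⟩ := exists_isItoIntegral_of_abs_le (hσGp.mul hHp)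
      (C := CG * CH) fun t ω ↦ by
        rw [abs_mul]
        exact mul_le_mul (hσGbd t ω) (hHbd t ω) (abs_nonneg _) ((abs_nonneg _).trans (hσGbd t ω))
    obtain ⟨K', hK', hK'M⟩ := exists_isItoIntegral_of_abs_le (hσGp.mul hFp)
      (C := CG * CF) fun t ω ↦ by
        rw [abs_mul]
        exact mul_le_mul (hσGbd t ω) (hFbd t ω) (abs_nonneg _) ((abs_nonneg _).trans (hσGbd t ω))
    exact ⟨K', hK'M, ae_mul_eq_of_isItoProcess hHa hHc hσGp hH hFa hFc (ae_of_all _ hFeq) haFint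
      hKX' hKX'M hK' hK'M⟩
  have hH₁bd : ∀ t ω, |h₁ (w t ω)| ≤ 1 := fun t ω ↦ hh₁bd _
  have hH₂bd : ∀ t ω, |h₂ (w t ω)| ≤ 1 := fun t ω ↦ hh₂bd _
  obtain ⟨K₁₁, hK₁₁M, h₁₁⟩ := hprod hH₁a hH₁c hH₁p hσG₁p hG₁ hσG₁bd hH₁bd hF₁a hF₁c hF₁p hF₁bd hF₁eq haF₁int
  obtain ⟨K₂₂, hK₂₂M, h₂₂⟩ := hprod hH₂a hH₂c hH₂p hσG₂p hG₂ hσG₂bd hH₂bd hF₂a hF₂c hF₂p hF₂bd hF₂eq haF₂int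
  obtain ⟨K₂₁, hK₂₁M, h₂₁⟩ := hprod hH₂a hH₂c hH₂p hσG₂p hG₂ hσG₂bd hH₂bd hF₁a hF₁c hF₁p hF₁bd hF₁eq haF₁int
  obtain ⟨K₁₂, hK₁₂M, h₁₂⟩ := hprod hH₁a hH₁c hH₁p hσG₁p hG₁ hσG₁bd hH₁bd hF₂a hF₂c hF₂p hF₂bd hF₂eq haF₂int
  ---------------------------------------------------------------------------
  -- Step 6: the drift vanishes identically (ODE at κ = 16/3)
  have hκ2 : (κ : ℂ) / 2 = 8 / 3 := by
    have : ((κ : ℝ) : ℂ) = (16 / 3 : ℝ) := by rw [hκ]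
    rw [show (κ : ℂ) = ((κ : ℝ) : ℂ) from rfl, this]
    push_cast
    ring
  have hdriftC : ∀ s ω, ((((h₁ (w s ω) : ℝ) : ℂ) + ((h₂ (w s ω) : ℝ) : ℂ) * I) *
      (((trunc σ aF₁u s ω : ℝ) : ℂ) + ((trunc σ aF₂u s ω : ℝ) : ℂ) * I) +
      (((F₁ s ω : ℝ) : ℂ) + ((F₂ s ω : ℝ) : ℂ) * I) * (((D₁ s ω : ℝ) : ℂ) + ((D₂ s ω : ℝ) : ℂ) * I)) = 0 := by
    intro s ω
    by_cases hs : (s : WithTop ℝ≥0) ≤ σ ω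
    · -- before `σ`: the equation
      have hvals : (((h₁ (w s ω) : ℝ) : ℂ) + ((h₂ (w s ω) : ℝ) : ℂ) * I) = ((w s ω : ℂ) + I) ^ c := by
        simp only [hh₁def, hh₂def]; exact re_add_im _
      have hd1v : (((deriv h₁ (w s ω) : ℝ) : ℂ) + ((deriv h₂ (w s ω) : ℝ) : ℂ) * I) =
          c * ((w s ω : ℂ) + I) ^ (c - 1) := by
        rw [hd1, hd2]; exact re_add_im _
      have hd2v : (((iteratedDeriv 2 h₁ (w s ω) : ℝ) : ℂ) + ((iteratedDeriv 2 h₂ (w s ω) : ℝ) : ℂ) * I) =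
          c * ((c - 1) * ((w s ω : ℂ) + I) ^ (c - 1 - 1)) := by
        rw [hdd1, hdd2]; exact re_add_im _
      have hode := slopeFun_ode (X s ω * (Y s ω)⁻¹)
      rw [← hκ2] at hode
      have key := fkObservable_itoDrift_eq_zero κ (x := X s ω) (y := Y s ω) (hYpos s ω).ne'
        (h0 := ((w s ω : ℂ) + I) ^ c) (h1 := c * ((w s ω : ℂ) + I) ^ (c - 1))
        (h2 := c * ((c - 1) * ((w s ω : ℂ) + I) ^ (c - 1 - 1))) (by
          simp only [hwdef, hAdef, hcdef] at hode ⊢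
          exact hode)
      -- express everything
      have hF : (((trunc σ aF₁u s ω : ℝ) : ℂ) + ((trunc σ aF₂u s ω : ℝ) : ℂ) * I) =
          (2⁻¹ : ℂ) * ((rateP s ω : ℂ) + I * (argP s ω)) * (((F₁ s ω : ℝ) : ℂ) + ((F₂ s ω : ℝ) : ℂ) * I) := by
        simp only [trunc_of_le hs, haF₁udef, haF₂udef]
        push_cast
        ring_nf
        rw [I_sq]
        ring
      have hD : (((D₁ s ω : ℝ) : ℂ) + ((D₂ s ω : ℝ) : ℂ) * I) = (bw s ω : ℂ) * (c * ((w s ω : ℂ) + I) ^ (c - 1)) +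
          (2⁻¹ : ℂ) * ((σw s ω ^ 2 : ℝ) : ℂ) * (c * ((c - 1) * ((w s ω : ℂ) + I) ^ (c - 1 - 1))) := by
        rw [← hd1v, ← hd2v]
        simp only [hD₁def, hD₂def]
        push_cast
        ring
      rw [hF, hD, hvals]
      have hbw : (bw s ω : ℝ) = X s ω * loewnerInvImDrift (X s ω) (Y s ω) +
          (Y s ω)⁻¹ * loewnerReDrift (X s ω) (Y s ω) := by
        simp only [hbwdef, haAdef, hbXdef, hAdef, trunc_of_le hs]
      have hσw2 : (σw s ω) ^ 2 = (-Real.sqrt κ * (Y s ω)⁻¹) ^ 2 := by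
        simp only [hσwdef, hσBdef, hAdef, trunc_of_le hs]
      rw [hbw, hσw2]
      have hrate : (rateP s ω : ℝ) = loewnerLogDerivRate (X s ω) (Y s ω) := rfl
      have harg : (argP s ω : ℝ) = 4 * X s ω * Y s ω / ((X s ω) ^ 2 + (Y s ω) ^ 2) ^ 2 := rfl
      rw [hrate, harg]
      linear_combination (((F₁ s ω : ℝ) : ℂ) + ((F₂ s ω : ℝ) : ℂ) * I) * key
    · -- after `σ`: all densities vanish
      have h1 : trunc σ aF₁u s ω = 0 := trunc_of_not_le hs
      have h2 : trunc σ aF₂u s ω = 0 := trunc_of_not_le hs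
      have h3 : D₁ s ω = 0 := by
        simp only [hD₁def, hbwdef, hσwdef, hσBdef, hbXdef, haAdef, trunc_of_not_le hs]; ring
      have h4 : D₂ s ω = 0 := by
        simp only [hD₂def, hbwdef, hσwdef, hσBdef, hbXdef, haAdef, trunc_of_not_le hs]; ring
      rw [h1, h2, h3, h4]
      push_cast
      ring
  have hdriftRe : ∀ s ω, h₁ (w s ω) * trunc σ aF₁u s ω + F₁ s ω * D₁ s ω -
      (h₂ (w s ω) * trunc σ aF₂u s ω + F₂ s ω * D₂ s ω) = 0 := by
    intro s ω
    have h := congrArg Complex.re (hdriftC s ω)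
    simp only [add_re, mul_re, mul_im, add_im, ofReal_re, ofReal_im, I_re, I_im, mul_zero, mul_one,
      sub_zero, add_zero, zero_add, zero_re] at h
    linear_combination h
  have hdriftIm : ∀ s ω, h₂ (w s ω) * trunc σ aF₁u s ω + F₁ s ω * D₂ s ω +
      (h₁ (w s ω) * trunc σ aF₂u s ω + F₂ s ω * D₁ s ω) = 0 := by
    intro s ω
    have h := congrArg Complex.im (hdriftC s ω)
    simp only [add_re, mul_re, mul_im, add_im, ofReal_re, ofReal_im, I_re, I_im, mul_zero, mul_one,
      sub_zero, add_zero, zero_add, zero_im] at h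
    linear_combination h
  ---------------------------------------------------------------------------
  -- Step 7: initial values and the martingales
  have hw0 : ∀ ω, w 0 ω = z.re / z.im := fun ω ↦ by
    simp only [hwdef, hAdef, hXdef, hYdef]
    rw [stoppedProcess_slePointRe_zero hz, stoppedProcess_slePointIm_zero hz, div_eq_mul_inv]
  have hR0 : ∀ ω, R 0 ω = 0 := fun ω ↦ timeIntegral_apply_zero _ ω
  have hΘ0 : ∀ ω, Θ 0 ω = 0 := fun ω ↦ timeIntegral_apply_zero _ ω
  have hF₁0 : ∀ ω, F₁ 0 ω = 1 := fun ω ↦ by simp only [hF₁def, hR0, hΘ0]; simp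
  have hF₂0 : ∀ ω, F₂ 0 ω = 0 := fun ω ↦ by simp only [hF₂def, hR0, hΘ0]; simp
  -- integrability of the drift pieces, for splitting the integrals
  have hpieceInt : ∀ {Hq Fq Dq aFq : ℝ≥0 → (ℝ≥0 → ℝ) → ℝ} (ω : ℝ≥0 → ℝ) (t : ℝ≥0),
      Continuous (Hq · ω) → Continuous (Fq · ω) →
      IntegrableOn (fun s : ℝ ↦ trunc σ aFq s.toNNReal ω) (Icc 0 t) →
      IntegrableOn (fun s : ℝ ↦ Dq s.toNNReal ω) (Icc 0 t) →
      IntervalIntegrable (fun s : ℝ ↦ Hq s.toNNReal ω * trunc σ aFq s.toNNReal ω +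
        Fq s.toNNReal ω * Dq s.toNNReal ω) volume 0 t := by
    intro Hq Fq Dq aFq ω t hHc hFc ha hD
    rw [intervalIntegrable_iff_integrableOn_Icc_of_le t.coe_nonneg]
    have hHi : ContinuousOn (fun s : ℝ ↦ Hq s.toNNReal ω) (Icc 0 t) :=
      (hHc.comp continuous_real_toNNReal).continuousOn
    have hFi : ContinuousOn (fun s : ℝ ↦ Fq s.toNNReal ω) (Icc 0 t) :=
      (hFc.comp continuous_real_toNNReal).continuousOn
    exact (ha.continuousOn_mul hHi isCompact_Icc).add (hD.continuousOn_mul hFi isCompact_Icc)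
  refine ⟨?_, ?_⟩
  · -- real part: `h₁(w) F₁ - h₂(w) F₂`
    have heq : (fun t ω ↦ (Complex.exp ((((R t ω : ℝ) : ℂ) + I * (Θ t ω : ℝ)) / 2) *
        (((w t ω : ℝ) : ℂ) + I) ^ (-(1 / 2 : ℂ))).re) =
        fun t ω ↦ h₁ (w t ω) * F₁ t ω - h₂ (w t ω) * F₂ t ω := by
      funext t ω
      have hexp : Complex.exp ((((R t ω : ℝ) : ℂ) + I * (Θ t ω : ℝ)) / 2) =
          ((F₁ t ω : ℝ) : ℂ) + ((F₂ t ω : ℝ) : ℂ) * I := by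
        have harg' : (((R t ω : ℝ) : ℂ) + I * (Θ t ω : ℝ)) / 2 =
            ((R t ω / 2 : ℝ) : ℂ) + ((Θ t ω / 2 : ℝ) : ℂ) * I := by
          push_cast; ring
        rw [harg', Complex.exp_add, Complex.exp_mul_I, ← Complex.ofReal_exp, ← Complex.ofReal_cos,
          ← Complex.ofReal_sin]
        simp only [hF₁def, hF₂def]
        push_cast
        ring
      rw [hexp]
      have hv : (((w t ω : ℝ) : ℂ) + I) ^ (-(1 / 2 : ℂ)) = ((h₁ (w t ω) : ℝ) : ℂ) + ((h₂ (w t ω) : ℝ) : ℂ) * I := by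
        simp only [hh₁def, hh₂def, hcdef]; exact (re_add_im _).symm
      rw [hv]
      simp only [add_re, mul_re, mul_im, add_im, ofReal_re, ofReal_im, I_re, I_im]
      ring
    rw [heq]
    have hae : ∀ᵐ ω ∂preWienerMeasure, ∀ t : ℝ≥0,
        h₁ (w t ω) * F₁ t ω - h₂ (w t ω) * F₂ t ω = h₁ (z.re / z.im) + (K₁₁ t ω - K₂₂ t ω) := by
      filter_upwards [h₁₁, h₂₂, haF₁int, haF₂int, hG₁.1, hG₂.1] with ω hω₁ hω₂ ha₁ ha₂ hD₁i hD₂i t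
      have e1 := hω₁ t
      have e2 := hω₂ t
      have hI1 := hpieceInt (Hq := fun t ω ↦ h₁ (w t ω)) (Fq := F₁) (Dq := D₁) (aFq := aF₁u)
        ω t (hH₁c ω) (hF₁c ω) (ha₁ t) (hD₁i t)
      have hI2 := hpieceInt (Hq := fun t ω ↦ h₂ (w t ω)) (Fq := F₂) (Dq := D₂) (aFq := aF₂u)
        ω t (hH₂c ω) (hF₂c ω) (ha₂ t) (hD₂i t)
      have hdiff : (∫ s in (0 : ℝ)..t, (h₁ (w s.toNNReal ω) * trunc σ aF₁u s.toNNReal ω +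
          F₁ s.toNNReal ω * D₁ s.toNNReal ω)) -
          (∫ s in (0 : ℝ)..t, (h₂ (w s.toNNReal ω) * trunc σ aF₂u s.toNNReal ω +
          F₂ s.toNNReal ω * D₂ s.toNNReal ω)) = 0 := by
        rw [← intervalIntegral.integral_sub hI1 hI2]
        simp only [hdriftRe, intervalIntegral.integral_zero]
      simp only [hw0, hF₁0, hF₂0] at e1 e2
      linear_combination e1 - e2 + hdiff
    have hMadapt : StronglyAdapted brownianFiltration fun t ω ↦ h₁ (w t ω) * F₁ t ω - h₂ (w t ω) * F₂ t ω :=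
      fun t ↦ ((hH₁a t).mul (hF₁a t)).sub ((hH₂a t).mul (hF₂a t))
    have h1 : Martingale (fun t ω ↦ h₁ (z.re / z.im) + (K₁₁ t ω - K₂₂ t ω)) brownianFiltration
        preWienerMeasure :=
      (martingale_const brownianFiltration preWienerMeasure (h₁ (z.re / z.im))).add (hK₁₁M.sub hK₂₂M)
    refine h1.congr hMadapt fun t ↦ ?_
    filter_upwards [hae] with ω hω
    exact (hω t).symm
  · -- imaginary part: `h₂(w) F₁ + h₁(w) F₂`
    have heq : (fun t ω ↦ (Complex.exp ((((R t ω : ℝ) : ℂ) + I * (Θ t ω : ℝ)) / 2) *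
        (((w t ω : ℝ) : ℂ) + I) ^ (-(1 / 2 : ℂ))).im) =
        fun t ω ↦ h₂ (w t ω) * F₁ t ω + h₁ (w t ω) * F₂ t ω := by
      funext t ω
      have hexp : Complex.exp ((((R t ω : ℝ) : ℂ) + I * (Θ t ω : ℝ)) / 2) =
          ((F₁ t ω : ℝ) : ℂ) + ((F₂ t ω : ℝ) : ℂ) * I := by
        have harg' : (((R t ω : ℝ) : ℂ) + I * (Θ t ω : ℝ)) / 2 =
            ((R t ω / 2 : ℝ) : ℂ) + ((Θ t ω / 2 : ℝ) : ℂ) * I := by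
          push_cast; ring
        rw [harg', Complex.exp_add, Complex.exp_mul_I, ← Complex.ofReal_exp, ← Complex.ofReal_cos,
          ← Complex.ofReal_sin]
        simp only [hF₁def, hF₂def]
        push_cast
        ring
      rw [hexp]
      have hv : (((w t ω : ℝ) : ℂ) + I) ^ (-(1 / 2 : ℂ)) = ((h₁ (w t ω) : ℝ) : ℂ) + ((h₂ (w t ω) : ℝ) : ℂ) * I := by
        simp only [hh₁def, hh₂def, hcdef]; exact (re_add_im _).symm
      rw [hv]
      simp only [add_re, mul_re, mul_im, add_im, ofReal_re, ofReal_im, I_re, I_im]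
      ring
    rw [heq]
    have hae : ∀ᵐ ω ∂preWienerMeasure, ∀ t : ℝ≥0,
        h₂ (w t ω) * F₁ t ω + h₁ (w t ω) * F₂ t ω = h₂ (z.re / z.im) + (K₂₁ t ω + K₁₂ t ω) := by
      filter_upwards [h₂₁, h₁₂, haF₁int, haF₂int, hG₁.1, hG₂.1] with ω hω₁ hω₂ ha₁ ha₂ hD₁i hD₂i t
      have e1 := hω₁ t
      have e2 := hω₂ t
      have hI1 := hpieceInt (Hq := fun t ω ↦ h₂ (w t ω)) (Fq := F₁) (Dq := D₂) (aFq := aF₁u)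
        ω t (hH₂c ω) (hF₁c ω) (ha₁ t) (hD₂i t)
      have hI2 := hpieceInt (Hq := fun t ω ↦ h₁ (w t ω)) (Fq := F₂) (Dq := D₁) (aFq := aF₂u)
        ω t (hH₁c ω) (hF₂c ω) (ha₂ t) (hD₁i t)
      have hsum : (∫ s in (0 : ℝ)..t, (h₂ (w s.toNNReal ω) * trunc σ aF₁u s.toNNReal ω +
          F₁ s.toNNReal ω * D₂ s.toNNReal ω)) +
          (∫ s in (0 : ℝ)..t, (h₁ (w s.toNNReal ω) * trunc σ aF₂u s.toNNReal ω +
          F₂ s.toNNReal ω * D₁ s.toNNReal ω)) = 0 := by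
        rw [← intervalIntegral.integral_add hI1 hI2]
        simp only [hdriftIm, intervalIntegral.integral_zero]
      simp only [hw0, hF₁0, hF₂0] at e1 e2
      linear_combination e1 + e2 + hsum
    have hMadapt : StronglyAdapted brownianFiltration fun t ω ↦ h₂ (w t ω) * F₁ t ω + h₁ (w t ω) * F₂ t ω :=
      fun t ↦ ((hH₂a t).mul (hF₁a t)).add ((hH₁a t).mul (hF₂a t))
    have h1 : Martingale (fun t ω ↦ h₂ (z.re / z.im) + (K₂₁ t ω + K₁₂ t ω)) brownianFiltration
        preWienerMeasure :=
      (martingale_const brownianFiltration preWienerMeasure (h₂ (z.re / z.im))).add (hK₂₁M.add hK₁₂M)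
    refine h1.congr hMadapt fun t ↦ ?_
    filter_upwards [hae] with ω hω
    exact (hω t).symm

end Main


/-! ### Identification with the FK observable on the imaginary axis -/

section Identification

variable {W : ℝ≥0 → ℝ} {z : ℂ}

/-- Pointwise identity: for `Z = x + iy ≠ 0`, `Im(-2/Z²) = 4xy/|Z|⁴`. [folklore] -/
theorem im_neg_two_div_mul_self (Z : ℂ) (hZ : Z ≠ 0) :
    (-2 / (Z * Z)).im = 4 * Z.re * Z.im / (Z.re ^ 2 + Z.im ^ 2) ^ 2 := by
  have hn : Complex.normSq Z ≠ 0 := (Complex.normSq_pos.2 hZ).ne'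
  have hq : Z.re ^ 2 + Z.im ^ 2 = Complex.normSq Z := by rw [Complex.normSq_apply]; ring
  rw [hq, Complex.div_im, Complex.normSq_mul]
  simp only [Complex.neg_re, Complex.neg_im, Complex.re_ofNat, Complex.im_ofNat, Complex.mul_re,
    Complex.mul_im, neg_zero, zero_mul, zero_div, zero_sub]
  rw [Complex.normSq_apply] at *
  field_simp
  ring

/-- **The Loewner derivative in modulus–argument form along the flow.** For `z ∈ ℍ` and
`t < T_z`: `g_t'(z) = (Im z_t / Im z) · exp ∫₀ᵗ (4y_s² + 4 i x_s y_s)/|z_s|⁴ ds`, `z_s = x_s + i y_s`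
the centred flow (`|g_t'| = ψ_t Im z_t / Im z`, `ψ_t = exp ∫ 4y²/|z|⁴`, Rohde–Schramm (2005)
eq. (6.3); `arg g_t' = Im ∫₀ᵗ -2/z_s² ds`). [cite: RohdeSchramm2005, eq. (3.3) and (6.3)] -/
theorem deriv_map_eq_mul_exp (hW : Continuous W) (hz : 0 < z.im) {t : ℝ≥0}
    (ht : (t : WithTop ℝ≥0) < swallowingTime W z) :
    deriv (map W t) z = (((centredMap W t z).im / z.im : ℝ) : ℂ) *
      Complex.exp (∫ s in (0 : ℝ)..t,
        (((loewnerLogDerivRate (centredMap W s.toNNReal z).re (centredMap W s.toNNReal z).im : ℝ) : ℂ) +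
          I * ((4 * (centredMap W s.toNNReal z).re * (centredMap W s.toNNReal z).im /
            ((centredMap W s.toNNReal z).re ^ 2 + (centredMap W s.toNNReal z).im ^ 2) ^ 2 : ℝ) : ℂ))) := by
  have hzW : z ≠ W 0 := ne_driving_of_im_pos hz 0
  obtain ⟨g, hg⟩ := exists_isSolution_swallowingTime_holds hW hzW
  have hD := hasDerivAt_map hW ht hg
  set J : ℂ := ∫ s in (0 : ℝ)..t, -2 / ((g s - W s.toNNReal) * (g s - W s.toNNReal)) with hJ
  rw [hD.deriv]
  have htT := toNNReal_coe_lt ht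
  -- along `[0, t]` the solution is the centred flow
  have hZ : ∀ s ∈ Icc (0 : ℝ) t, g s - W s.toNNReal = centredMap W s.toNNReal z := by
    intro s hs
    have hs' : ((s.toNNReal : ℝ≥0) : WithTop ℝ≥0) < swallowingTime W z := (Icc_subset_timeDomain htT hs).2
    rw [centredMap_eq_of_isSolution hW hg hs', Real.coe_toNNReal _ hs.1]
  have hZne : ∀ s ∈ Icc (0 : ℝ) t, centredMap W s.toNNReal z ≠ 0 := fun s hs ↦
    centredMap_ne_zero hW hz (Icc_subset_timeDomain htT hs).2
  -- continuity of the integrand pieces on `[0, t]`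
  have hcZ : ContinuousOn (fun s : ℝ ↦ centredMap W s.toNNReal z) (Icc 0 t) := by
    refine (continuousOn_centredMap hW hzW).comp continuous_real_toNNReal.continuousOn fun s hs ↦ ?_
    exact (Icc_subset_timeDomain htT hs).2
  have hint : IntervalIntegrable (fun s ↦ -2 / ((g s - W s.toNNReal) * (g s - W s.toNNReal))) volume 0 t :=
    ((hg.continuousOn_coeff hW hg htT htT).mono (by rw [uIcc_of_le t.coe_nonneg])).intervalIntegrable
  -- real and imaginary parts of `J`
  have hJim : J.im = ∫ s in (0 : ℝ)..t, (4 * (centredMap W s.toNNReal z).re * (centredMap W s.toNNReal z).im /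
      ((centredMap W s.toNNReal z).re ^ 2 + (centredMap W s.toNNReal z).im ^ 2) ^ 2 : ℝ) := by
    have h1 := Complex.imCLM.intervalIntegral_comp_comm hint
    simp only [Complex.imCLM_apply] at h1
    rw [hJ, ← h1]
    refine intervalIntegral.integral_congr fun s hs ↦ ?_
    rw [uIcc_of_le t.coe_nonneg] at hs
    show (-2 / ((g s - W s.toNNReal) * (g s - W s.toNNReal))).im = _
    rw [hZ s hs, im_neg_two_div_mul_self _ (hZne s hs)]
  have hnorm : ‖Complex.exp J‖ = Real.exp (∫ s in (0 : ℝ)..t,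
      loewnerLogDerivRate (centredMap W s.toNNReal z).re (centredMap W s.toNNReal z).im) *
      ((centredMap W t z).im / z.im) := by
    rw [← hD.deriv]
    have hψ := derivRatio_eq_exp hW hz ht
    rw [derivRatio_apply] at hψ
    have hY : 0 < (map W t z).im := by rw [← im_centredMap]; exact im_centredMap_pos hW hz ht
    have hrate : (∫ s in (0 : ℝ)..t, derivRatioRate W z s) = ∫ s in (0 : ℝ)..t,
        loewnerLogDerivRate (centredMap W s.toNNReal z).re (centredMap W s.toNNReal z).im :=
      intervalIntegral.integral_congr fun s _ ↦ derivRatioRate_eq_loewnerLogDerivRate W z s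
    rw [← hrate, ← hψ, im_centredMap]
    field_simp
  -- continuity of the two real integrands on `[0, t]`
  have hre : ContinuousOn (fun s : ℝ ↦ (centredMap W s.toNNReal z).re) (Icc 0 t) :=
    Complex.continuous_re.comp_continuousOn hcZ
  have him : ContinuousOn (fun s : ℝ ↦ (centredMap W s.toNNReal z).im) (Icc 0 t) :=
    Complex.continuous_im.comp_continuousOn hcZ
  have himpos : ∀ s ∈ Icc (0 : ℝ) t, 0 < (centredMap W s.toNNReal z).im := fun s hs ↦
    im_centredMap_pos hW hz (Icc_subset_timeDomain htT hs).2
  have hQ : ∀ s ∈ Icc (0 : ℝ) t, (centredMap W s.toNNReal z).re ^ 2 + (centredMap W s.toNNReal z).im ^ 2 ≠ 0 :=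
    fun s hs ↦ by have := himpos s hs; positivity
  have hrateC : ContinuousOn (fun s : ℝ ↦ loewnerLogDerivRate (centredMap W s.toNNReal z).re
      (centredMap W s.toNNReal z).im) (Icc 0 t) := by
    simp only [loewnerLogDerivRate_apply]
    exact (continuousOn_const.mul (him.pow 2)).div ((hre.pow 2).add (him.pow 2) |>.pow 2)
      fun s hs ↦ pow_ne_zero 2 (hQ s hs)
  have hargC : ContinuousOn (fun s : ℝ ↦ 4 * (centredMap W s.toNNReal z).re * (centredMap W s.toNNReal z).im /
      ((centredMap W s.toNNReal z).re ^ 2 + (centredMap W s.toNNReal z).im ^ 2) ^ 2) (Icc 0 t) :=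
    ((continuousOn_const.mul hre).mul him).div ((hre.pow 2).add (him.pow 2) |>.pow 2)
      fun s hs ↦ pow_ne_zero 2 (hQ s hs)
  have hI1 : IntervalIntegrable (fun s : ℝ ↦ ((loewnerLogDerivRate (centredMap W s.toNNReal z).re
      (centredMap W s.toNNReal z).im : ℝ) : ℂ)) volume 0 t := by
    refine ContinuousOn.intervalIntegrable ?_
    rw [uIcc_of_le t.coe_nonneg]
    exact Complex.continuous_ofReal.comp_continuousOn hrateC
  have hI2 : IntervalIntegrable (fun s : ℝ ↦ I * ((4 * (centredMap W s.toNNReal z).re * (centredMap W s.toNNReal z).im /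
      ((centredMap W s.toNNReal z).re ^ 2 + (centredMap W s.toNNReal z).im ^ 2) ^ 2 : ℝ) : ℂ)) volume 0 t := by
    refine ContinuousOn.intervalIntegrable ?_
    rw [uIcc_of_le t.coe_nonneg]
    exact continuousOn_const.mul (Complex.continuous_ofReal.comp_continuousOn hargC)
  set Rint : ℝ := ∫ s in (0 : ℝ)..t, loewnerLogDerivRate (centredMap W s.toNNReal z).re
      (centredMap W s.toNNReal z).im with hRint
  set Aint : ℝ := ∫ s in (0 : ℝ)..t, (4 * (centredMap W s.toNNReal z).re * (centredMap W s.toNNReal z).im /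
      ((centredMap W s.toNNReal z).re ^ 2 + (centredMap W s.toNNReal z).im ^ 2) ^ 2 : ℝ) with hAint
  -- left side in polar form
  have hL : Complex.exp J = ((Real.exp Rint * ((centredMap W t z).im / z.im) : ℝ) : ℂ) *
      (Complex.cos (Aint : ℂ) + Complex.sin (Aint : ℂ) * I) := by
    have h1 := Complex.exp_eq_exp_re_mul_sin_add_cos J
    rw [← Complex.ofReal_exp, ← Complex.norm_exp, hnorm, hJim] at h1
    exact h1
  -- right side in polar form
  have hR : Complex.exp (∫ s in (0 : ℝ)..t,
      (((loewnerLogDerivRate (centredMap W s.toNNReal z).re (centredMap W s.toNNReal z).im : ℝ) : ℂ) +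
        I * ((4 * (centredMap W s.toNNReal z).re * (centredMap W s.toNNReal z).im /
          ((centredMap W s.toNNReal z).re ^ 2 + (centredMap W s.toNNReal z).im ^ 2) ^ 2 : ℝ) : ℂ))) =
      ((Real.exp Rint : ℝ) : ℂ) * (Complex.cos (Aint : ℂ) + Complex.sin (Aint : ℂ) * I) := by
    rw [intervalIntegral.integral_add hI1 hI2, intervalIntegral.integral_const_mul,
      intervalIntegral.integral_ofReal, intervalIntegral.integral_ofReal, Complex.exp_add, ← hRint, ← hAint,
      mul_comm I, Complex.exp_mul_I, ← Complex.ofReal_exp]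
  rw [hL, hR]
  push_cast
  ring

/-- **The square of the FK observable in slope coordinates** (`z = iy`, `y > 0`, `t < T_z`): the
base `iy g_t'(iy)/(g_t(iy) - W_t)` of the observable equals `i · exp(Λ_t)/(w_t + i)`, where
`Λ_t = ∫₀ᵗ (4y_s² + 4ix_sy_s)/|z_s|⁴ ds` and `w_t = x_t/y_t` is the slope of the centred flow
(`z_t = y_t (w_t + i)`). [cite: DuminilCopinSmirnov2012Clay, Prop. 6.7 (proof, p. 29)] -/
theorem fkObservable_base_eq (hW : Continuous W) {y : ℝ} (hy : 0 < y) {t : ℝ≥0}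
    (ht : (t : WithTop ℝ≥0) < swallowingTime W (I * y)) :
    I * y * deriv (map W t) (I * y) / (map W t (I * y) - W t) =
      I * Complex.exp (∫ s in (0 : ℝ)..t,
        (((loewnerLogDerivRate (centredMap W s.toNNReal (I * y)).re (centredMap W s.toNNReal (I * y)).im : ℝ) : ℂ) +
          I * ((4 * (centredMap W s.toNNReal (I * y)).re * (centredMap W s.toNNReal (I * y)).im /
            ((centredMap W s.toNNReal (I * y)).re ^ 2 + (centredMap W s.toNNReal (I * y)).im ^ 2) ^ 2 : ℝ) : ℂ))) /
        ((cotArg W (I * y) t : ℂ) + I) := by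
  have hz : 0 < (I * y : ℂ).im := by simpa using hy
  rw [deriv_map_eq_mul_exp hW hz ht, ← centredMap_apply]
  set E := Complex.exp (∫ s in (0 : ℝ)..t,
        (((loewnerLogDerivRate (centredMap W s.toNNReal (I * y)).re (centredMap W s.toNNReal (I * y)).im : ℝ) : ℂ) +
          I * ((4 * (centredMap W s.toNNReal (I * y)).re * (centredMap W s.toNNReal (I * y)).im /
            ((centredMap W s.toNNReal (I * y)).re ^ 2 + (centredMap W s.toNNReal (I * y)).im ^ 2) ^ 2 : ℝ) : ℂ)))
  set Z := centredMap W t (I * y) with hZ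
  have hYpos : 0 < Z.im := im_centredMap_pos hW hz ht
  have hZne : Z ≠ 0 := centredMap_ne_zero hW hz ht
  have hYne : (Z.im : ℂ) ≠ 0 := Complex.ofReal_ne_zero.2 hYpos.ne'
  have hZeq : Z = (Z.im : ℂ) * ((cotArg W (I * y) t : ℂ) + I) := by
    rw [cotArg_apply, ← hZ, Complex.ofReal_div, mul_add, mul_div_cancel₀ _ hYne]
    exact (Complex.re_add_im Z).symm
  have hwI : ((cotArg W (I * y) t : ℂ) + I) ≠ 0 := ofReal_add_I_ne_zero _
  have hyne : (y : ℂ) ≠ 0 := Complex.ofReal_ne_zero.2 hy.ne'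
  have him' : (I * (y : ℂ)).im = y := by simp
  rw [him']
  obtain ⟨Yv, hYv⟩ : ∃ Yv : ℝ, Z.im = Yv := ⟨_, rfl⟩
  rw [hYv] at hZeq hYne ⊢
  rw [hZeq]
  push_cast
  field_simp

/-- **Uniqueness of continuous square roots along an interval.** If `f, g : ℝ≥0 → ℂ` are
continuous on `[0, u]`, `f² = g²` there, `g ≠ 0` there and `f 0 = g 0`, then `f u = g u` (the
continuous function `Re(f/g)` takes values in `{1, -1}` and is `1` at `0`: intermediate value
theorem). [folklore] -/
theorem eq_of_sq_eq_of_continuousOn {f g : ℝ≥0 → ℂ} {u : ℝ≥0} (hf : ContinuousOn f (Icc 0 u))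
    (hg : ContinuousOn g (Icc 0 u)) (hsq : ∀ v ∈ Icc 0 u, f v ^ 2 = g v ^ 2)
    (hne : ∀ v ∈ Icc 0 u, g v ≠ 0) (h0 : f 0 = g 0) : f u = g u := by
  have hq : ∀ v ∈ Icc 0 u, f v / g v = 1 ∨ f v / g v = -1 := by
    intro v hv
    have h1 : (f v / g v) ^ 2 = 1 := by rw [div_pow, hsq v hv, div_self (pow_ne_zero 2 (hne v hv))]
    have h2 : (f v / g v - 1) * (f v / g v + 1) = 0 := by linear_combination h1
    rcases mul_eq_zero.1 h2 with h | h
    · left; exact sub_eq_zero.1 h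
    · right; exact eq_neg_of_add_eq_zero_left h
  have hcont : ContinuousOn (fun v ↦ (f v / g v).re) (Icc 0 u) :=
    Complex.continuous_re.comp_continuousOn (hf.div hg hne)
  have h0u : (0 : ℝ≥0) ≤ u := bot_le
  have h0' : (f 0 / g 0).re = 1 := by rw [h0, div_self (hne 0 ⟨le_rfl, h0u⟩)]; simp
  have hu : u ∈ Icc (0 : ℝ≥0) u := ⟨h0u, le_rfl⟩
  rcases hq u hu with h | h
  · rw [div_eq_one_iff_eq (hne u hu)] at h; exact h
  · exfalso
    have hre : (f u / g u).re = -1 := by rw [h]; simp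
    have hmem : (0 : ℝ) ∈ Icc ((fun v ↦ (f v / g v).re) u) ((fun v ↦ (f v / g v).re) 0) := by
      simp only [hre, h0']; norm_num
    obtain ⟨v, hv, hv0⟩ := intermediate_value_Icc' h0u hcont hmem
    have hv0' : (f v / g v).re = 0 := hv0
    rcases hq v hv with h' | h'
    · rw [h'] at hv0'; simp at hv0'
    · rw [h'] at hv0'; simp at hv0'

end Identification


/-! ### The stopped observable process in product form -/

section StoppedObservable

variable {κ : ℝ≥0} {n : ℕ} {σ : (ℝ≥0 → ℝ) → WithTop ℝ≥0}

/-- **The FK observable of the SLE chain in slope coordinates, at a stopped clock.** For `y > 0`,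
`z = iy`, a random time `σ ≤ ρₙ ∧ y²/9`, every `t` and every path `ω`: the time-limited FK
observable process stopped at `σ` equals `i^{1/2} · exp(½Λ) · (w + i)^{-1/2}` evaluated on the
`σ`-stopped flow (`Λ = ∫₀^{t∧σ} (4y² + 4ixy)/|z|⁴`, `w = x/y`): both are continuous square roots
of `i y g'/(g - W) = i e^{Λ}/(w + i)` (`fkObservable_base_eq`) equal to `1` at time `0`.
[cite: DuminilCopinSmirnov2012Clay, Prop. 6.7 (proof, p. 29)] -/
theorem stoppedProcess_observableProcess_eq {y : ℝ} (hy : 0 < y)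
    (hσρ : ∀ ω, σ ω ≤ slePointLocTime κ (I * y) n ω)
    (hσT : ∀ ω, σ ω ≤ (cdhksTime y : ℝ≥0)) (t : ℝ≥0) (ω : ℝ≥0 → ℝ) :
    stoppedProcess (observableProcess (fun t ω ↦ sleDriving κ ω t) y) σ t ω =
      (I : ℂ) ^ (2⁻¹ : ℂ) *
        (Complex.exp ((((timeIntegral (trunc σ fun s ω ↦ loewnerLogDerivRate
          (stoppedProcess (slePointRe κ (I * y)) σ s ω) (stoppedProcess (slePointIm κ (I * y)) σ s ω)) t ω : ℝ) : ℂ) +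
          I * (timeIntegral (trunc σ fun s ω ↦ 4 * stoppedProcess (slePointRe κ (I * y)) σ s ω *
            stoppedProcess (slePointIm κ (I * y)) σ s ω / ((stoppedProcess (slePointRe κ (I * y)) σ s ω) ^ 2 +
            (stoppedProcess (slePointIm κ (I * y)) σ s ω) ^ 2) ^ 2) t ω : ℝ)) / 2) *
          ((((stoppedProcess (slePointRe κ (I * y)) σ t ω * (stoppedProcess (slePointIm κ (I * y)) σ t ω)⁻¹ : ℝ)) : ℂ)
            + I) ^ (-(1 / 2 : ℂ))) := by
  set z : ℂ := I * y with hzdef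
  have hz : 0 < z.im := by simp [hzdef, hy]
  set W : ℝ≥0 → ℝ := sleDriving κ ω with hWdef
  have hW : Continuous W := continuous_sleDriving κ ω
  set u : ℝ≥0 := (min (t : WithTop ℝ≥0) (σ ω)).untopA with hu
  have huσ : (u : WithTop ℝ≥0) ≤ σ ω := Loewner.coe_untopA_min_le t (σ ω)
  have huT : u ≤ cdhksTime y := WithTop.coe_le_coe.1 (huσ.trans (hσT ω))
  have huS : (u : WithTop ℝ≥0) < swallowingTime W z := coe_untopA_min_lt_swallowingTime hz hσρ t ω
  have hST : ShortTime W (I * y) u := (shortTime_cdhksTime hW hy).mono huT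
  -- the two functions of the clock
  set Λ : ℝ≥0 → ℂ := fun v ↦ ∫ s in (0 : ℝ)..v,
    (((loewnerLogDerivRate (centredMap W s.toNNReal z).re (centredMap W s.toNNReal z).im : ℝ) : ℂ) +
      I * ((4 * (centredMap W s.toNNReal z).re * (centredMap W s.toNNReal z).im /
        ((centredMap W s.toNNReal z).re ^ 2 + (centredMap W s.toNNReal z).im ^ 2) ^ 2 : ℝ) : ℂ)) with hΛ
  set f : ℝ≥0 → ℂ := fun v ↦ fkObservable W v z with hf
  set g : ℝ≥0 → ℂ := fun v ↦ (I : ℂ) ^ (2⁻¹ : ℂ) * (Complex.exp (Λ v / 2) *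
    (((cotArg W z v : ℝ) : ℂ) + I) ^ (-(1 / 2 : ℂ))) with hg
  -- times in `[0, u]` are before the swallowing time
  have hvS : ∀ v ∈ Icc (0 : ℝ≥0) u, (v : WithTop ℝ≥0) < swallowingTime W z := fun v hv ↦
    lt_of_le_of_lt (WithTop.coe_le_coe.2 hv.2) huS
  -- squares
  have hI2 : ((I : ℂ) ^ (2⁻¹ : ℂ)) ^ 2 = I := by simp
  have hhalf : ∀ c : ℂ, c ≠ 0 → (c ^ (-(1 / 2 : ℂ))) ^ 2 = c⁻¹ := fun c hc ↦ by
    rw [sq, ← Complex.cpow_add _ _ hc, show (-(1 / 2 : ℂ)) + -(1 / 2 : ℂ) = -1 by ring, Complex.cpow_neg_one]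
  have hsqg : ∀ v ∈ Icc (0 : ℝ≥0) u, g v ^ 2 = I * Complex.exp (Λ v) / (((cotArg W z v : ℝ) : ℂ) + I) := by
    intro v _
    simp only [hg]
    rw [mul_pow, mul_pow, hI2, hhalf _ (ofReal_add_I_ne_zero _), sq, ← Complex.exp_add, add_halves]
    ring
  have hsqf : ∀ v ∈ Icc (0 : ℝ≥0) u, f v ^ 2 = I * Complex.exp (Λ v) / (((cotArg W z v : ℝ) : ℂ) + I) := by
    intro v hv
    simp only [hf, fkObservable]
    rw [Complex.cpow_ofNat_inv_pow, hzdef, fkObservable_base_eq hW hy (hvS v hv)]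
  have hgne : ∀ v ∈ Icc (0 : ℝ≥0) u, g v ≠ 0 := by
    intro v _
    simp only [hg]
    refine mul_ne_zero ?_ (mul_ne_zero (Complex.exp_ne_zero _) ?_)
    · rw [Ne, Complex.cpow_eq_zero_iff]; simp [Complex.I_ne_zero]
    · rw [Ne, Complex.cpow_eq_zero_iff]
      exact fun h ↦ ofReal_add_I_ne_zero _ h.1
  -- continuity on `[0, u]`
  have hfc : ContinuousOn f (Icc 0 u) := hST.continuousOn_fkObservable
  have hcZ : ContinuousOn (fun s : ℝ ↦ centredMap W s.toNNReal z) (Icc 0 u) := by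
    refine (continuousOn_centredMap hW (ne_driving_of_im_pos hz 0)).comp
      continuous_real_toNNReal.continuousOn fun s hs ↦ ?_
    exact (Icc_subset_timeDomain (toNNReal_coe_lt huS) hs).2
  have hre : ContinuousOn (fun s : ℝ ↦ (centredMap W s.toNNReal z).re) (Icc 0 u) :=
    Complex.continuous_re.comp_continuousOn hcZ
  have him : ContinuousOn (fun s : ℝ ↦ (centredMap W s.toNNReal z).im) (Icc 0 u) :=
    Complex.continuous_im.comp_continuousOn hcZ
  have hQ : ∀ s ∈ Icc (0 : ℝ) u, (centredMap W s.toNNReal z).re ^ 2 + (centredMap W s.toNNReal z).im ^ 2 ≠ 0 :=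
    fun s hs ↦ by
      have := im_centredMap_pos hW hz (Icc_subset_timeDomain (toNNReal_coe_lt huS) hs).2
      positivity
  have hintegrand : ContinuousOn (fun s : ℝ ↦
      (((loewnerLogDerivRate (centredMap W s.toNNReal z).re (centredMap W s.toNNReal z).im : ℝ) : ℂ) +
        I * ((4 * (centredMap W s.toNNReal z).re * (centredMap W s.toNNReal z).im /
          ((centredMap W s.toNNReal z).re ^ 2 + (centredMap W s.toNNReal z).im ^ 2) ^ 2 : ℝ) : ℂ))) (Icc 0 u) := by
    refine (Complex.continuous_ofReal.comp_continuousOn ?_).add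
      (continuousOn_const.mul (Complex.continuous_ofReal.comp_continuousOn ?_))
    · simp only [loewnerLogDerivRate_apply]
      exact (continuousOn_const.mul (him.pow 2)).div ((hre.pow 2).add (him.pow 2) |>.pow 2)
        fun s hs ↦ pow_ne_zero 2 (hQ s hs)
    · exact ((continuousOn_const.mul hre).mul him).div ((hre.pow 2).add (him.pow 2) |>.pow 2)
        fun s hs ↦ pow_ne_zero 2 (hQ s hs)
  have hΛc : ContinuousOn Λ (Icc 0 u) := by
    have h1 : ContinuousOn (fun x : ℝ ↦ ∫ s in (0 : ℝ)..x,
        (((loewnerLogDerivRate (centredMap W s.toNNReal z).re (centredMap W s.toNNReal z).im : ℝ) : ℂ) +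
          I * ((4 * (centredMap W s.toNNReal z).re * (centredMap W s.toNNReal z).im /
            ((centredMap W s.toNNReal z).re ^ 2 + (centredMap W s.toNNReal z).im ^ 2) ^ 2 : ℝ) : ℂ))) (Icc 0 u) := by
      have := intervalIntegral.continuousOn_primitive_interval (μ := volume) (a := (0 : ℝ)) (b := (u : ℝ))
        (by rw [uIcc_of_le u.coe_nonneg]; exact hintegrand.integrableOn_compact isCompact_Icc)
      rwa [uIcc_of_le u.coe_nonneg] at this
    refine h1.comp NNReal.continuous_coe.continuousOn fun v hv ↦ ⟨v.coe_nonneg, NNReal.coe_le_coe.2 hv.2⟩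
  have hcotc : ContinuousOn (fun v : ℝ≥0 ↦ ((cotArg W z v : ℝ) : ℂ) + I) (Icc 0 u) :=
    (Complex.continuous_ofReal.comp_continuousOn ((continuousOn_cotArg hW hz).mono fun v hv ↦ hvS v hv)).add
      continuousOn_const
  have hgc : ContinuousOn g (Icc 0 u) := by
    refine continuousOn_const.mul ((Complex.continuous_exp.comp_continuousOn (hΛc.div_const 2)).mul
      (hcotc.cpow_const fun v _ ↦ ofReal_add_I_mem_slitPlane _))
  -- values at time `0`
  have hcot0 : cotArg W z 0 = 0 := by
    rw [hWdef, cotArg_sleDriving_zero κ ω hz]; simp [hzdef]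
  have hΛ0 : Λ 0 = 0 := by simp [hΛ]
  have h0S : (0 : ℝ≥0) ∈ Icc (0 : ℝ≥0) u := ⟨le_rfl, bot_le⟩
  have hg0 : g 0 = 1 := by
    simp only [hg]
    rw [hΛ0, hcot0, zero_div, Complex.exp_zero, one_mul, Complex.ofReal_zero, zero_add,
      ← Complex.cpow_add _ _ Complex.I_ne_zero, show (2⁻¹ : ℂ) + -(1 / 2 : ℂ) = 0 by ring, Complex.cpow_zero]
  have hf0 : f 0 = 1 := by
    have h1 := hsqf 0 h0S
    rw [hΛ0, hcot0, Complex.exp_zero, Complex.ofReal_zero, zero_add, mul_one, div_self Complex.I_ne_zero] at h1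
    -- `f 0` is the principal square root of `f 0 ^ 2 = 1`
    simp only [hf, fkObservable] at h1 ⊢
    rw [Complex.cpow_ofNat_inv_pow] at h1
    rw [h1, Complex.one_cpow]
  have hfg : f u = g u :=
    eq_of_sq_eq_of_continuousOn hfc hgc (fun v hv ↦ by rw [hsqf v hv, hsqg v hv]) hgne (by rw [hf0, hg0])
  -- read both sides of the claim at the clock `u`
  have hL : stoppedProcess (observableProcess (fun t ω ↦ sleDriving κ ω t) y) σ t ω = f u := by
    simp only [hf, stoppedProcess, observableProcess_apply, ← hu, min_eq_left huT]
    rfl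
  rw [hL, hfg]
  simp only [hg]
  congr 2
  · -- the exponent
    congr 1
    have hint1 : ∀ {G : ℝ → ℝ → ℝ}, timeIntegral (trunc σ fun s ω ↦ G
        (stoppedProcess (slePointRe κ (I * y)) σ s ω) (stoppedProcess (slePointIm κ (I * y)) σ s ω)) t ω =
        ∫ s in (0 : ℝ)..u, G (centredMap W s.toNNReal z).re (centredMap W s.toNNReal z).im := by
      intro G
      rw [timeIntegral_trunc]
      simp only [timeIntegral, ← hu]
      refine intervalIntegral.integral_congr fun r hr ↦ ?_
      rw [uIcc_of_le (NNReal.coe_nonneg _)] at hr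
      have hrσ : ((r.toNNReal : ℝ≥0) : WithTop ℝ≥0) ≤ σ ω := coe_toNNReal_le_of_le_untopA_min hr.2
      have hrT := coe_lt_swallowingTime_of_le_locTime hz (hrσ.trans (hσρ ω))
      simp only [stoppedProcess_eq_of_le hrσ]
      rw [slePointIm_of_lt hrT, slePointRe]
    rw [hint1 (G := loewnerLogDerivRate), hint1 (G := fun a b ↦ 4 * a * b / (a ^ 2 + b ^ 2) ^ 2)]
    simp only [hΛ]
    have hI1 : IntervalIntegrable (fun s : ℝ ↦ ((loewnerLogDerivRate (centredMap W s.toNNReal z).re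
        (centredMap W s.toNNReal z).im : ℝ) : ℂ)) volume 0 u := by
      refine ContinuousOn.intervalIntegrable ?_
      rw [uIcc_of_le u.coe_nonneg]
      refine Complex.continuous_ofReal.comp_continuousOn ?_
      simp only [loewnerLogDerivRate_apply]
      exact (continuousOn_const.mul (him.pow 2)).div ((hre.pow 2).add (him.pow 2) |>.pow 2)
        fun s hs ↦ pow_ne_zero 2 (hQ s hs)
    have hI2 : IntervalIntegrable (fun s : ℝ ↦ I * ((4 * (centredMap W s.toNNReal z).re * (centredMap W s.toNNReal z).im /
        ((centredMap W s.toNNReal z).re ^ 2 + (centredMap W s.toNNReal z).im ^ 2) ^ 2 : ℝ) : ℂ)) volume 0 u := by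
      refine ContinuousOn.intervalIntegrable ?_
      rw [uIcc_of_le u.coe_nonneg]
      exact continuousOn_const.mul (Complex.continuous_ofReal.comp_continuousOn
        (((continuousOn_const.mul hre).mul him).div ((hre.pow 2).add (him.pow 2) |>.pow 2)
          fun s hs ↦ pow_ne_zero 2 (hQ s hs)))
    rw [intervalIntegral.integral_add hI1 hI2, intervalIntegral.integral_const_mul,
      intervalIntegral.integral_ofReal, intervalIntegral.integral_ofReal]
  · -- the slope
    congr 2
    have := stopped_div_eq_cotArg hz hσρ t ω
    rw [div_eq_mul_inv] at this
    rw [this, ← hu]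

/-- **The time-limited FK observable of the SLE(16/3) chain, stopped at `σ ≤ ρₙ ∧ y²/9` with
bounded slope, has martingale real and imaginary parts** (Itô step + identification).
[cite: DuminilCopinSmirnov2012Clay, Prop. 6.7 (proof, p. 29)] -/
theorem martingale_re_im_stoppedProcess_observableProcess (hκ : (κ : ℝ) = 16 / 3) {y : ℝ} (hy : 0 < y)
    (hσ : IsStoppingTime brownianFiltration σ) (hσρ : ∀ ω, σ ω ≤ slePointLocTime κ (I * y) n ω)
    (hσT : ∀ ω, σ ω ≤ (cdhksTime y : ℝ≥0))
    {S : ℝ} (hS : ∀ (ω : ℝ≥0 → ℝ) (t : ℝ≥0), (t : WithTop ℝ≥0) ≤ σ ω →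
      |cotArg (sleDriving κ ω) (I * y) t| ≤ S) :
    Martingale (fun t ω ↦ (stoppedProcess (observableProcess (fun t ω ↦ sleDriving κ ω t) y) σ t ω).re)
      brownianFiltration preWienerMeasure ∧
    Martingale (fun t ω ↦ (stoppedProcess (observableProcess (fun t ω ↦ sleDriving κ ω t) y) σ t ω).im)
      brownianFiltration preWienerMeasure := by
  have hz : 0 < (I * y : ℂ).im := by simp [hy]
  obtain ⟨hP1, hP2⟩ := martingale_re_im_fkProduct hκ hz hσ hσρ hS
  have heq := stoppedProcess_observableProcess_eq (κ := κ) hy hσρ hσT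
  constructor
  · have hfun : (fun t ω ↦ (stoppedProcess (observableProcess (fun t ω ↦ sleDriving κ ω t) y) σ t ω).re) =
        ((I : ℂ) ^ (2⁻¹ : ℂ)).re • (fun t ω ↦ (Complex.exp ((((timeIntegral (trunc σ fun s ω ↦ loewnerLogDerivRate
          (stoppedProcess (slePointRe κ (I * y)) σ s ω) (stoppedProcess (slePointIm κ (I * y)) σ s ω)) t ω : ℝ) : ℂ) +
          I * (timeIntegral (trunc σ fun s ω ↦ 4 * stoppedProcess (slePointRe κ (I * y)) σ s ω *
            stoppedProcess (slePointIm κ (I * y)) σ s ω / ((stoppedProcess (slePointRe κ (I * y)) σ s ω) ^ 2 +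
            (stoppedProcess (slePointIm κ (I * y)) σ s ω) ^ 2) ^ 2) t ω : ℝ)) / 2) *
          ((((stoppedProcess (slePointRe κ (I * y)) σ t ω * (stoppedProcess (slePointIm κ (I * y)) σ t ω)⁻¹ : ℝ)) : ℂ)
            + I) ^ (-(1 / 2 : ℂ))).re) -
        ((I : ℂ) ^ (2⁻¹ : ℂ)).im • (fun t ω ↦ (Complex.exp ((((timeIntegral (trunc σ fun s ω ↦ loewnerLogDerivRate
          (stoppedProcess (slePointRe κ (I * y)) σ s ω) (stoppedProcess (slePointIm κ (I * y)) σ s ω)) t ω : ℝ) : ℂ) +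
          I * (timeIntegral (trunc σ fun s ω ↦ 4 * stoppedProcess (slePointRe κ (I * y)) σ s ω *
            stoppedProcess (slePointIm κ (I * y)) σ s ω / ((stoppedProcess (slePointRe κ (I * y)) σ s ω) ^ 2 +
            (stoppedProcess (slePointIm κ (I * y)) σ s ω) ^ 2) ^ 2) t ω : ℝ)) / 2) *
          ((((stoppedProcess (slePointRe κ (I * y)) σ t ω * (stoppedProcess (slePointIm κ (I * y)) σ t ω)⁻¹ : ℝ)) : ℂ)
            + I) ^ (-(1 / 2 : ℂ))).im) := by
      funext t ω
      rw [heq t ω]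
      simp only [Pi.sub_apply, Pi.smul_apply, smul_eq_mul]
      rw [Complex.mul_re]
    rw [hfun]
    exact (hP1.smul _).sub (hP2.smul _)
  · have hfun : (fun t ω ↦ (stoppedProcess (observableProcess (fun t ω ↦ sleDriving κ ω t) y) σ t ω).im) =
        ((I : ℂ) ^ (2⁻¹ : ℂ)).re • (fun t ω ↦ (Complex.exp ((((timeIntegral (trunc σ fun s ω ↦ loewnerLogDerivRate
          (stoppedProcess (slePointRe κ (I * y)) σ s ω) (stoppedProcess (slePointIm κ (I * y)) σ s ω)) t ω : ℝ) : ℂ) +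
          I * (timeIntegral (trunc σ fun s ω ↦ 4 * stoppedProcess (slePointRe κ (I * y)) σ s ω *
            stoppedProcess (slePointIm κ (I * y)) σ s ω / ((stoppedProcess (slePointRe κ (I * y)) σ s ω) ^ 2 +
            (stoppedProcess (slePointIm κ (I * y)) σ s ω) ^ 2) ^ 2) t ω : ℝ)) / 2) *
          ((((stoppedProcess (slePointRe κ (I * y)) σ t ω * (stoppedProcess (slePointIm κ (I * y)) σ t ω)⁻¹ : ℝ)) : ℂ)
            + I) ^ (-(1 / 2 : ℂ))).im) +
        ((I : ℂ) ^ (2⁻¹ : ℂ)).im • (fun t ω ↦ (Complex.exp ((((timeIntegral (trunc σ fun s ω ↦ loewnerLogDerivRate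
          (stoppedProcess (slePointRe κ (I * y)) σ s ω) (stoppedProcess (slePointIm κ (I * y)) σ s ω)) t ω : ℝ) : ℂ) +
          I * (timeIntegral (trunc σ fun s ω ↦ 4 * stoppedProcess (slePointRe κ (I * y)) σ s ω *
            stoppedProcess (slePointIm κ (I * y)) σ s ω / ((stoppedProcess (slePointRe κ (I * y)) σ s ω) ^ 2 +
            (stoppedProcess (slePointIm κ (I * y)) σ s ω) ^ 2) ^ 2) t ω : ℝ)) / 2) *
          ((((stoppedProcess (slePointRe κ (I * y)) σ t ω * (stoppedProcess (slePointIm κ (I * y)) σ t ω)⁻¹ : ℝ)) : ℂ)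
            + I) ^ (-(1 / 2 : ℂ))).re) := by
      funext t ω
      rw [heq t ω]
      simp only [Pi.add_apply, Pi.smul_apply, smul_eq_mul]
      rw [Complex.mul_im]
    rw [hfun]
    exact (hP2.smul _).add (hP1.smul _)

end StoppedObservable


/-! ### The limit `n → ∞`: the time-limited observable process itself -/

section Limit

variable {κ : ℝ≥0}

/-- **For SLE(16/3) the real and imaginary parts of the time-limited FK observable process are
martingales** of the raw Brownian filtration under the pre-Wiener measure: with `W = √κ B`,
`κ = 16/3`, `y > 0`, the process `N^y_t = O_{t ∧ y²/9}(iy) = (iy g'/(g - W))^{1/2}_{t∧y²/9}`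
(`Loewner.observableProcess`) has martingale real and imaginary parts. This is the continuum
counterpart of Duminil-Copin–Smirnov's "`√π M_t^z = √(g_t'(z)/(g_t(z) - W_t))` is a martingale"
(Clay Math. Proc. 15 (2012), proof of Prop. 6.7, p. 29; CDHKS 2014 §3, `T(z) = (Im w)²/9`):
bounded limits (`n → ∞` in the localization) of the stopped martingales of
`martingale_re_im_stoppedProcess_observableProcess`.
[cite: DuminilCopinSmirnov2012Clay, Prop. 6.7 (proof, p. 29)] [cite: CDHKSCRAS2014, §3] -/
theorem martingale_re_im_observableProcess_sle (hκ : (κ : ℝ) = 16 / 3) {y : ℝ} (hy : 0 < y) :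
    Martingale (fun t ω ↦ (observableProcess (fun t ω ↦ sleDriving κ ω t) y t ω).re)
      brownianFiltration preWienerMeasure ∧
    Martingale (fun t ω ↦ (observableProcess (fun t ω ↦ sleDriving κ ω t) y t ω).im)
      brownianFiltration preWienerMeasure := by
  haveI := isProbabilityMeasure_preWienerMeasure'
  set z : ℂ := I * y with hzdef
  have hz : 0 < z.im := by simp [hzdef, hy]
  have hz0 : |z.re / z.im| < ((0 : ℕ) : ℝ) + 1 := by simp [hzdef]
  -- the localizing stopping times
  set σ : ℕ → (ℝ≥0 → ℝ) → WithTop ℝ≥0 := fun n ω ↦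
    min ((cdhksTime y : ℝ≥0) : WithTop ℝ≥0) (sleCotArgLocTime κ z ((n : ℝ) + 1) n ω) with hσdef
  have hσst : ∀ n, IsStoppingTime brownianFiltration (σ n) := fun n ↦
    (isStoppingTime_const _ _).min (isStoppingTime_sleCotArgLocTime hz _ n)
  have hσρ : ∀ n ω, σ n ω ≤ slePointLocTime κ (I * y) n ω := fun n ω ↦
    (min_le_right _ _).trans (sleCotArgLocTime_le_locTime _ n ω)
  have hσT : ∀ n ω, σ n ω ≤ (cdhksTime y : ℝ≥0) := fun n ω ↦ min_le_left _ _
  have hS : ∀ n (ω : ℝ≥0 → ℝ) (t : ℝ≥0), (t : WithTop ℝ≥0) ≤ σ n ω →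
      |cotArg (sleDriving κ ω) (I * y) t| ≤ (n : ℝ) + 1 := fun n ω t ht ↦ by
    have hzn : |z.re / z.im| < (n : ℝ) + 1 := by simp [hzdef]; positivity
    exact abs_cotArg_le_of_le_sleCotArgLocTime hz hzn (ht.trans (min_le_right _ _))
  have hM := fun n ↦ martingale_re_im_stoppedProcess_observableProcess (n := n) hκ hy (hσst n) (hσρ n) (hσT n) (hS n)
  have hWc : ∀ ω : ℝ≥0 → ℝ, Continuous (fun t ↦ sleDriving κ ω t) := fun ω ↦ continuous_sleDriving κ ω
  -- pointwise eventual equality with the unstopped process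
  have hev : ∀ (t : ℝ≥0) (ω : ℝ≥0 → ℝ), ∀ᶠ n in atTop,
      stoppedProcess (observableProcess (fun t ω ↦ sleDriving κ ω t) y) (σ n) t ω =
        observableProcess (fun t ω ↦ sleDriving κ ω t) y t ω := by
    intro t ω
    set W := sleDriving κ ω with hW
    have hWcont : Continuous W := continuous_sleDriving κ ω
    have hT : ((cdhksTime y : ℝ≥0) : WithTop ℝ≥0) < swallowingTime W z := (shortTime_cdhksTime hWcont hy).lt
    obtain ⟨N₁, hN₁⟩ := exists_le_slePointLocTime (κ := κ) hz ω hT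
    -- slope bound on `[0, y²/9]`
    obtain ⟨B, hB⟩ : ∃ B, ∀ v ∈ Icc (0 : ℝ≥0) (cdhksTime y), |cotArg W z v| ≤ B := by
      have hc : ContinuousOn (fun v ↦ |cotArg W z v|) (Icc (0 : ℝ≥0) (cdhksTime y)) :=
        (continuousOn_abs_cotArg hWcont hz).mono fun v hv ↦ lt_of_le_of_lt (WithTop.coe_le_coe.2 hv.2) hT
      obtain ⟨B, hB⟩ := isCompact_Icc.exists_bound_of_continuousOn hc
      exact ⟨B, fun v hv ↦ by simpa [Real.norm_eq_abs] using hB v hv⟩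
    have hexit : ∀ n : ℕ, B < (n : ℝ) + 1 →
        ((cdhksTime y : ℝ≥0) : WithTop ℝ≥0) ≤ cotArgExitTime W z ((n : ℝ) + 1) := by
      intro n hn
      by_contra hlt
      push Not at hlt
      obtain ⟨t₀, ht₀, -, habs⟩ := exists_cotArgExitTime_eq_coe hWcont hz (s := (n : ℝ) + 1) (ne_top_of_lt hlt)
      rw [ht₀, WithTop.coe_lt_coe] at hlt
      have := hB t₀ ⟨bot_le, hlt.le⟩
      linarith
    refine (eventually_ge_atTop (max N₁ (Nat.ceil B))).mono fun n hn ↦ ?_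
    have hn1 : N₁ ≤ n := le_of_max_le_left hn
    have hn2 : B < (n : ℝ) + 1 := by
      have : (Nat.ceil B : ℝ) ≤ n := by exact_mod_cast le_of_max_le_right hn
      linarith [Nat.le_ceil B]
    have hσn : σ n ω = ((cdhksTime y : ℝ≥0) : WithTop ℝ≥0) := by
      simp only [hσdef]
      refine min_eq_left (le_min (hexit n hn2) (hN₁ n hn1))
    simp only [stoppedProcess, hσn, observableProcess_apply]
    rw [← WithTop.coe_min]
    change fkObservable _ (min (min t (cdhksTime y)) (cdhksTime y)) _ = _
    rw [min_assoc, min_self]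
  have hbd : ∀ n (t : ℝ≥0) (ω : ℝ≥0 → ℝ),
      ‖stoppedProcess (observableProcess (fun t ω ↦ sleDriving κ ω t) y) (σ n) t ω‖ ≤ 2 := fun n t ω ↦
    norm_observableProcess_le hWc hy _ ω
  constructor
  · refine martingale_of_tendsto_of_abs_le' (fun n ↦ (hM n).1) (C := fun _ ↦ 2)
      (fun n t ω ↦ (abs_re_le_norm _).trans (hbd n t ω)) fun t ω ↦ ?_
    refine tendsto_const_nhds.congr' ((hev t ω).mono fun n hn ↦ ?_)
    show _ = (stoppedProcess (observableProcess (fun t ω ↦ sleDriving κ ω t) y) (σ n) t ω).re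
    rw [hn]
  · refine martingale_of_tendsto_of_abs_le' (fun n ↦ (hM n).2) (C := fun _ ↦ 2)
      (fun n t ω ↦ (abs_im_le_norm _).trans (hbd n t ω)) fun t ω ↦ ?_
    refine tendsto_const_nhds.congr' ((hev t ω).mono fun n hn ↦ ?_)
    show _ = (stoppedProcess (observableProcess (fun t ω ↦ sleDriving κ ω t) y) (σ n) t ω).im
    rw [hn]

/-! ### The cylinder identity -/

/-- **A bounded `𝓕_s`-measurable multiplier tests the martingale property**: for a real
martingale `X` and `G` strongly `𝓕_s`-measurable with `|G| ≤ c`, `∫ (X_t - X_s) G = 0` for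
`s ≤ t` (pull-out property of the conditional expectation). [folklore] -/
theorem integral_sub_mul_eq_zero_of_martingale {Ω : Type*} {m : MeasurableSpace Ω}
    {P : Measure Ω} [IsFiniteMeasure P] {𝓕 : Filtration ℝ≥0 m} {X : ℝ≥0 → Ω → ℝ}
    (hX : Martingale X 𝓕 P) {s t : ℝ≥0} (hst : s ≤ t) {G : Ω → ℝ}
    (hG : StronglyMeasurable[𝓕 s] G) {c : ℝ} (hGc : ∀ ω, |G ω| ≤ c) :
    ∫ ω, (X t ω - X s ω) * G ω ∂P = 0 := by
  have hGm : AEStronglyMeasurable G P := (hG.mono (𝓕.le s)).aestronglyMeasurable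
  have hint : ∀ r, Integrable (fun ω ↦ G ω * X r ω) P := fun r ↦
    (hX.integrable r).bdd_mul hGm (ae_of_all _ fun ω ↦ by rw [Real.norm_eq_abs]; exact hGc ω)
  have h1 : ∫ ω, G ω * X t ω ∂P = ∫ ω, G ω * X s ω ∂P := by
    rw [← integral_condExp (𝓕.le s) (f := fun ω ↦ G ω * X t ω)]
    refine integral_congr_ae ?_
    have h2 := condExp_stronglyMeasurable_mul_of_bound (𝓕.le s) hG (hX.integrable t) c
      (ae_of_all _ fun ω ↦ by rw [Real.norm_eq_abs]; exact hGc ω)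
    filter_upwards [h2, hX.condExp_ae_eq hst] with ω hω hω'
    rw [show (fun ω ↦ G ω * X t ω) = G * X t from rfl, hω, Pi.mul_apply, hω']
  have heq : (fun ω ↦ (X t ω - X s ω) * G ω) = fun ω ↦ G ω * X t ω - G ω * X s ω := by
    funext ω; ring
  rw [heq, integral_sub (hint t) (hint s), h1, sub_self]

/-- **CDHKS's cylinder identity for SLE(16/3)** on the canonical space: for `κ = 16/3`, `y > 0`,
`s ≤ t`, times `S_k ≤ s` and continuous `|ψ| ≤ 1`,
`E[(N^y_t - N^y_s) ψ(W_{S_0}, …, W_{S_{n-1}})] = 0`, `W = √κ B`, `N^y` the time-limited FK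
observable process — the identity (M5′) of
`LatticeModels.exists_cylinderObservableIdentity_fkInterface` holds for the SLE(16/3) driving
process. [cite: CDHKSCRAS2014, §3] [cite: DuminilCopinSmirnov2012Clay, Prop. 6.7 (proof, p. 29)] -/
theorem integral_observableProcess_cylinder_sle (hκ : (κ : ℝ) = 16 / 3) {y : ℝ} (hy : 0 < y)
    {s t : ℝ≥0} (hst : s ≤ t) {n : ℕ} {S : Fin n → ℝ≥0} (hS : ∀ k, S k ≤ s)
    {ψ : (Fin n → ℝ) → ℝ} (hψc : Continuous ψ) (hψ1 : ∀ v, |ψ v| ≤ 1) :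
    ∫ ω, (observableProcess (fun t ω ↦ sleDriving κ ω t) y t ω -
        observableProcess (fun t ω ↦ sleDriving κ ω t) y s ω) *
      (ψ (fun k ↦ sleDriving κ ω (S k)) : ℂ) ∂preWienerMeasure = 0 := by
  haveI := isProbabilityMeasure_preWienerMeasure'
  obtain ⟨hre, him⟩ := martingale_re_im_observableProcess_sle hκ hy
  have hV : Measurable[brownianFiltration s] (fun ω : ℝ≥0 → ℝ ↦ fun k : Fin n ↦ sleDriving κ ω (S k)) :=
    @measurable_pi_lambda (ℝ≥0 → ℝ) (Fin n) (fun _ ↦ ℝ) (brownianFiltration s) (fun _ ↦ inferInstance) _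
      fun k ↦ measurable_sleDriving_of_le κ (hS k)
  have hG : StronglyMeasurable[brownianFiltration s] fun ω : ℝ≥0 → ℝ ↦ ψ (fun k ↦ sleDriving κ ω (S k)) :=
    (hψc.measurable.comp hV).stronglyMeasurable
  have h1 := integral_sub_mul_eq_zero_of_martingale hre hst hG (c := 1) fun ω ↦ hψ1 _
  have h2 := integral_sub_mul_eq_zero_of_martingale him hst hG (c := 1) fun ω ↦ hψ1 _
  -- integrability of the complex integrand (bounded by `4`, measurable)
  have hWc : ∀ ω : ℝ≥0 → ℝ, Continuous (fun t ↦ sleDriving κ ω t) := fun ω ↦ continuous_sleDriving κ ω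
  have hN : ∀ r, Measurable (observableProcess (fun t ω ↦ sleDriving κ ω t) y r) := fun r ↦
    measurable_observableProcess (t := r) hWc (fun u _ ↦ measurable_sleDriving κ u) hy
  have hψm : Measurable fun ω : ℝ≥0 → ℝ ↦ (ψ (fun k ↦ sleDriving κ ω (S k)) : ℂ) :=
    Complex.measurable_ofReal.comp (hψc.measurable.comp (measurable_pi_lambda _ fun k ↦ measurable_sleDriving κ (S k)))
  have hI : Integrable (fun ω ↦ (observableProcess (fun t ω ↦ sleDriving κ ω t) y t ω -
      observableProcess (fun t ω ↦ sleDriving κ ω t) y s ω) * (ψ (fun k ↦ sleDriving κ ω (S k)) : ℂ))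
      preWienerMeasure := by
    refine (integrable_const (4 : ℝ)).mono' (((hN t).sub (hN s)).mul hψm).aestronglyMeasurable
      (ae_of_all _ fun ω ↦ ?_)
    rw [norm_mul, Complex.norm_real, Real.norm_eq_abs]
    have ht := norm_observableProcess_le hWc hy t ω
    have hs := norm_observableProcess_le hWc hy s ω
    have h3 : ‖observableProcess (fun t ω ↦ sleDriving κ ω t) y t ω -
        observableProcess (fun t ω ↦ sleDriving κ ω t) y s ω‖ ≤ 4 := (norm_sub_le _ _).trans (by linarith)
    calc _ ≤ 4 * 1 := mul_le_mul h3 (hψ1 _) (abs_nonneg _) (by norm_num)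
      _ = 4 := by norm_num
  apply Complex.ext
  · have h3 := integral_re hI
    simp only [RCLike.re_to_complex, Complex.zero_re] at h3 ⊢
    rw [← h3, ← h1]
    refine integral_congr_ae (ae_of_all _ fun ω ↦ ?_)
    simp only [Complex.mul_re, Complex.sub_re, Complex.ofReal_re, Complex.ofReal_im, mul_zero, sub_zero]
  · have h3 := integral_im hI
    simp only [RCLike.im_to_complex, Complex.zero_im] at h3 ⊢
    rw [← h3, ← h2]
    refine integral_congr_ae (ae_of_all _ fun ω ↦ ?_)
    simp only [Complex.mul_im, Complex.sub_im, Complex.ofReal_re, Complex.ofReal_im, mul_zero, zero_add]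

end Limit

end Literature.Probability.RandomPlanarGeometry
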